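import Literature.MathematicalPhysics.QuantumFieldTheory.SecondSymanzikFactorization
import Literature.MathematicalPhysics.QuantumFieldTheory.Volkov2016.OnShellDenominatorRayOrder
import Literature.MathematicalPhysics.QuantumFieldTheory.Volkov2016.OneTreePolynomialQuotientFactorization
import HarnessLib

/-!
# Volkov 2016 (ЖЭТФ 149, 1164 = JETP 122, 1008) §5.3 (25): «W/V ∼ W_{G′}/V_{G′} + W_{G/G′}/V_{G/G′}» along the IR vector — PROVED for every connected edge list under the abstract form of the §5.2 hypotheses, as a graded polynomial identity for the on-shell denominator and as the printed asymptotic relation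

independent recomputation; certified where stated, statistical where stated; no new-physics claim.

CITATION HEADER (venture `QEDPrecision`, cell `pub-qed`, track TROPICAL seat V3a = `pub-qed-trop-v3-lit-1` gen 32; VALUE-FREE: identities
between polynomials attached to an ARBITRARY finite edge list with marked vertices and marked line sets, and limits of their ratios
along monomial paths — no Feynman integrand, no constant, nothing per Set V family, graph or word of the cell). Fourth file of the
ЖЭТФ §5.2–§5.3 group of this seat: `OnShellDenominatorCoefficients.lean` (p394119: sign of the coefficients of `W`),
`OneTreePolynomialRayOrder.lean` (p394173/p394342: `ord V`), `OnShellDenominatorRayOrder.lean` (p394773: «W/V ≍ δ²»),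
`OneTreePolynomialQuotientFactorization.lean` (p396107/p396275: (24)₁ «V_{G′}V_{G/G′} ∼ V» and App. C's V-chain step). That last
header lists «(25) W/V ∼ W_{G′}/V_{G′} + W_{G/G′}/V_{G/G′} (signed cycle-trees, numerators, on-shell denominator — print-only)»
under NOT CLAIMED; this file types (25). The proof is NOT the printed one (V16 proves (25) by the electric-circuit identity (26),
«более нагляден»); it is the «более сложные комбинаторные рассуждения» the paper alludes to, assembled from Brown's UV and IR
factorisation theorems for the second Symanzik polynomial (the LIT seat's `SecondSymanzikFactorization.lean`, p396027) once
Volkov's `S` is identified with the massless second Symanzik polynomial for a unit scalar momentum through `u → w` (§3).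

SOURCE [Volkov2016]: С. А. Волков, «Вычитательная процедура для вычисления аномального магнитного момента электрона в КЭД и её
применение для численного расчёта на трёхпетлевом уровне», ЖЭТФ 149 (6) 1164–1191 (2016) = S. A. Volkov, J. Exp. Theor. Phys. 122 (6)
1008–1031 (2016), doi 10.1134/S1063776116050113; Russian original held by the cell (HOME `data/lit/sources/.cache/zhetf149_1164_Volkov2016/
r_149_1164.pdf`, page texts `…/journal-pdf-pages/ZhETF149-1164-Volkov2016/pNNNN.txt`, PDF page N = journal page 1163 + N; locators «journal
page = pNN:Lnn»). VERBATIM. §5.1, p.1174 (PDF p.11): the definitions of `V`, `S` («сумма по всем 2-деревьям, для которых вершины,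
инцидентные электронным внешним линиям G, лежат в разных компонентах связности, произведений z_l по хордам данных 2-деревьев»),
`z_e`, `W = S − V z_e` (typed in `OnShellDenominatorCoefficients.lean`). §5.2, p.1175 (p12:L81–L88): «Инфракрасной расходимости
соответствуют значения β_j = 2 для линий из G′, β_j = 1 для линий из P₁ и P₂, β_j = 0 для остальных линий … V ≍ δ^{N_{G′}−1}
(доминирующее по степени δ дерево состоит из P₁, P₂ и любого 1-дерева G′)»; p.1176 (p13:L29): «W/V ≍ δ²»; footnote 16 (p12:L96–L99):
«f(δ) ≍ g(δ) означает, что 0 < C₁ < |f(δ)/g(δ)| < C₂ …; f ∼ g означает lim f/g = 1». §5.3, p.1177 (p14:L21–L56): the counterterm's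
function is «Σ_{K₁≥1} Σ_{K₂≥0} C_{K₁+K₂} F^{G′}_{K₁} F^{G/G′}_{K₂} (W_{G′}/V_{G′} + W_{G/G′}/V_{G/G′})^{K₁+K₂}, при этом величины F^{G′}_{K₁},
F^{G/G′}_{K₂}, W_{G′}, W_{G/G′}, V_{G′}, V_{G/G′} строятся по правилам, аналогичным описанным выше для построения F_K, W, V»; footnote 17
(p14:L67–L71): «Через G/G′ здесь и далее обозначается граф, получающийся из G заменой подграфа G′ на вершину»; p.1178 (p15:L56–L91):
«Слагаемые в I′(z), соответствующие заданному выбору пар электронных линий в G′, имеют в точности такое же асимптотическое поведение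
при δ → 0, как и соответствующие слагаемые в I(z) … Совпадение асимптотики вытекает из (23) и следующих асимптотических равенств:
V_{G′}V_{G/G′} ∼ V, … (24)   **W/V ∼ W_{G′}/V_{G′} + W_{G/G′}/V_{G/G′}. (25)**   Основная идея здесь в том, что если все величины B…,
V…, Q̂… расписать в виде суммы произведений, оставить только доминирующие по степени δ слагаемые, то мы получим точные равенства.»;
(p15:L92–L97): «Для доказательства (25), однако, нужны более сложные комбинаторные рассуждения, но мы применим другой метод, который
более нагляден и без труда обобщается на случай вложенных друг в друга ИК-расходящихся подграфов (см. Приложение C). Будем использовать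
аналогию с электрическими цепями …» ⟦To prove (25), however, more complicated combinatorial arguments are needed, but we shall apply
another method, which is more transparent … the analogy with electric circuits⟧; §6.2, p.1182–1183 (p19:L81–L96, p20:L4–L14), the
printed 2-loop instance: «˜X^{[4]} = (m²/V^{[4]})[z₅(z₁+z₂)(z₃+z₄+z₆) + z₆(z₃+z₄)(z₁+z₂+z₅) − z₅(z₁+z₂)(z₃+z₄)] − m²(z₁+z₂+z₃+z₄) … (39)»,
«Для ˜X^{[4]} это вытекает из (39): ˜X^{[4]} ∼ … = ˜X^{[2]}(z₁,z₂,z₅) + ˜X^{[2]}(z₃,z₄,z₆) + O(δ³) + O(δ³)» (G′ = {1,2,5}, P₁ ∪ P₂ = {3,4}).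
[Brown2017] F. Brown, Commun. Number Theory Phys. 11 (2017) 453–556 = arXiv:1512.06409v3, Prop. 2.2 (UV factorisation `Φ_G = Ψ_γ
Φ_{G/γ} + R^{UV}`, `deg_γ R > h_γ`) and Prop. 2.4 (IR factorisation `Φ_G = Φ_γ Ψ_{G/γ} + R^{IR}`, `deg_γ R > h_γ + 1`, `γ` momentum
spanning) — used through the LIT seat's typed theorems, cited there verbatim. [Oxley2011] J. Oxley, *Matroid Theory* (2nd ed.), §3.1
Prop. 3.1.7 (bases of a contraction; `M(G/T) = M(G)/T`) — the DICTIONARY for `G/G′`, as in the companions.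

MODEL (the tree's). `E : Fin N → Fin (V+1) × Fin (V+1)` an edge list; `u`, `w` the vertices of the external electron lines of `G`;
`Pe` the electron lines («электронные линии», for `z_e`); `γ` the lines of `G′`; `a`, `b` the vertices at which the electron path
enters and leaves `G′` (the external electron vertices OF `G′`); `P := Pe ∖ γ` the lines of `P₁ ∪ P₂` and `A := γ ∪ Pe` those of
`G′ ∪ P₁ ∪ P₂`; the IR vector `irVector γ Pe = 𝟙_γ + 𝟙_{γ∪Pe}` (2 on `γ`, 1 on `P`, 0 elsewhere; = the companion's `fun e =>
setIndicator γ e + setIndicator (γ ∪ P) e`). `V = kirchhoffPolynomial`, `S = twoTreePolynomial`, `z_e = lineSum Pe`, `W = wPolynomial`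
(companions); `V_{G′} = subgraphPolynomial E γ` (= the LIT seat's `kirchhoffSub`, `rfl`), `V_{G/G′} = quotientPolynomial E γ`
(= `kirchhoffQuot`, `rfl`); NEW (4 definitions with bodies, each Volkov's object for `G′` resp. `G/G′` in the matroid dictionary of the
companions — 2-trees of `G′` = independent `F′ ⊆ γ` with `|F′| = rk γ − 1`, 2-trees of `G/G′` = independent sets `T′` of `M(G)/γ`
with `|T′| = |V| − rk γ − 2`, their components read on the graphs `F′` resp. `γ ∪ T′` of `G`): **`twoTreePolynomialSub E γ a b`** =
`S_{G′}`, **`twoTreePolynomialQuot E γ u w`** = `S_{G/G′}`, **`wPolynomialSub E γ a b Pe`** = `W_{G′} = S_{G′} − V_{G′} z_{e′}` (`e′ = Pe ∩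
γ`), **`wPolynomialQuot E γ u w Pe`** = `W_{G/G′} = S_{G/G′} − V_{G/G′} z_{e″}` (`e″ = Pe ∖ γ`); plus the bookkeeping **`weightPart R β
k`** (the weight-`k` part of a polynomial along a real weight — App. A's grouping; `initForm R β = weightPart R β (rayOrder R β)`,
`rfl`), **`unitMomentum u w`** (the kinematics behind `S`) and **`irVector γ Pe`**. THE PRINTED QED SETTING IS ABSTRACTED INTO FOUR
HYPOTHESES, each the edge-list form of a sentence of §5.2–§5.3 (flagged; evident for a QED magnetic-moment graph without lepton loops
with a vertexlike `G′ ∌` the external electron vertices, not modelled here): (Hℓ) `ℓ(γ ∪ Pe) = ℓ(γ)` — «P₁, P₂ и любое 1-дерево G′»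
form a 1-tree of `G′ ∪ P₁ ∪ P₂` (the companion `OnShellDenominatorRayOrder`'s (H2)); (Hγ) `a ~_γ b` — `G′` is connected and contains
`a`, `b`; (HP₁) `u ~_{Pe∖γ} a`, (HP₂) `b ~_{Pe∖γ} w` — the electron path outside `G′` joins `u` to `a` and `b` to `w`. The asymptotic
statements of §8 add «W/V ≍ δ²» in the form `ord W = ord V + 2` of the companion (its (H1)–(H5), or its two QED witnesses
`rayOrder_wPolynomial_eq_of_inner_cycle` / `_of_outer_line`, discharge it) and `u ~_{Pe} w` (the companion's (H4), for the sign).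

WHAT THE KERNEL CERTIFIES (all PROVED; 0 named facts, 0 sorry):
* §1 `weightPart` and its algebra: `coeff_`/`support_weightPart`, additivity, `weightPart_mul_left/right` (graded Leibniz rule for a
  homogeneous factor), `weightPart_eq_of_remainder` (leading part + remainder ⇒ the part), `rayOrder_eq_of_forall_le_of_weightPart_ne_zero`
  (order and initial form from a lower bound and a non-zero part), **`tendsto_rpow_neg_mul_eval_weightPart`** (`δ^{−k} R(cδ^β) →
  (R)_k(c)` when all weights are `≥ k`), `eval_rayPath_of_forall_eq` (homogeneous ⇒ exact scaling).
* §3 **`twoTreePolynomial_eq_secondSymanzikPolynomial`**: Volkov's `S` IS `Φ_G` (massless) for the unit momentum `u → w`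
  (`‖flow‖² = [F separates u from w]`, `norm_sq_momentumFlow_unitMomentum`); §4 the dictionaries `twoTreePolynomialSub_eq_secondSymanzikSub`
  (`S_{G′} = Ξ_γ` with `G′`'s own kinematics `a → b`), `twoTreePolynomialQuot_eq_secondSymanzikQuot` (`S_{G/G′} = Ξ_{G/γ}`),
  `edgeRank_union_of_contract_indep`, `natCard_connectedComponent_union_eq_two` (a 2-tree of `G/G′` has two components on `V_G`).
* §5 the two conversion lemmas between `A = γ ∪ P` and `(γ, P)`: **`not_reachable_union_sdiff`** (the separation transfer
  `a ≁_{F′} b ⇒ u ≁_{F′∪P} w`, by the strict submodularity of the rank across a disconnection), **`weightPart_secondSymanzikSub_union_eq`**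
  (`Ξ_A` at `P`-degree 0 = `S_{G′}`: the 2-trees of `G′ ∪ P₁ ∪ P₂` containing `P₁ ∪ P₂` and separating `u|w` are the `F′ ∪ P`, `F′` a
  2-tree of `G′` separating `a|b`), `contract_indep_sdiff`, **`weightPart_kirchhoffQuot_setIndicator_zero`** (`Ψ_{G/γ}` at `P`-degree 0 =
  `Ψ_{G/A}`: `M/(γ∪P) = (M/γ)/P`).
* §6 **`weightPart_twoTreePolynomial_irVector`** — THE COMBINATORIAL CORE: under (Hℓ), (Hγ), (HP₁), (HP₂), for every connected edge
  list, `(S)_{2ℓ(γ)+2} = V_{G′}·(S_{G/G′})₂ + S_{G′}·(V_{G/G′})₀` along the IR vector. Mechanism: every monomial of `S` has `deg_γ ≥ ℓ(γ)`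
  (UV, `loopNumber_le_sdeg_of_mem_support_twoTreePolynomial`) and `deg_A ≥ ℓ(A) + 1` (IR at the momentum-spanning `A`,
  `loopNumber_succ_le_sdeg_…`), so weight `2ℓ + 2` is carried by exactly two classes: `(deg_γ, deg_A) = (ℓ, ℓ+2)` — Brown's UV class at
  `γ` with two `P`-chords (`weightPart_twoTreePolynomial_setIndicator_eq` = Prop. 2.2 for `S`) — and `(ℓ+1, ℓ+1)` — Brown's IR class `C₁`
  at `A` with no `P`-chord (`weightPart_twoTreePolynomial_setIndicator_union_eq` = Prop. 2.4 for `S`), converted by §5.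
* §7 **`weightPart_wPolynomial_irVector`** — (25) FOR `W`, GRADED FORM: `(W)_{2ℓ+2} = V_{G′}·(W_{G/G′})₂ + W_{G′}·(V_{G/G′})₀`, same
  hypotheses (no sign, bridge or witness hypothesis), via Brown's factorisation of `V` in weight form
  (`weightPart_kirchhoffPolynomial_irVector_of_lt_two`: `(V)_{2ℓ+k} = V_{G′}(V_{G/G′})_k` for `k < 2`) and `z_e = z_{e′} + z_{e″}` of
  weights `2`, `1`.
* §8 the printed asymptotic statements: `weightPart_quotientPolynomial_irVector_zero` (**`(V_{G/G′})₀ = V_{G/(G′∪P₁∪P₂)}`**),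
  `rayOrder_quotientPolynomial_irVector` (`ord V_{G/G′} = 0`, `in_β V_{G/G′} = V_{G/(G′∪P₁∪P₂)}`), **`rayOrder_kirchhoffPolynomial_irVector_eq`**
  (`ord V = 2ℓ(γ)` AND `in_β V = V_{G′}·V_{G/(G′∪P₁∪P₂)}` — the companions' «V ≍ δ^{N_{G′}−1}» and (24)₁ with the second factor in
  closed form, under (Hℓ) alone), homogeneity of `V_{G′}`, `S_{G′}`, `W_{G′}` (weights `2ℓ`, `2ℓ+2`, `2ℓ+2`),
  **`weightPart_wPolynomialQuot_irVector_zero`** (`(W_{G/G′})₀ = 0`), **`weightPart_wPolynomial_irVector_succ`** (`(W)_{2ℓ+1} =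
  V_{G′}·(W_{G/G′})₁`: the next-to-leading cancellation of §5.2 happens inside `G/G′`), `two_le_linPair_of_mem_support_wPolynomialQuot`,
  `initForm_wPolynomial_irVector_eq`, `wPolynomialSub_div_rayPath` (`W_{G′}/V_{G′}` along the ray is exactly `δ²·W_{G′}(c)/V_{G′}(c)`),
  `eval_subgraphPolynomial_pos`, `eval_weightPart_quotientPolynomial_pos`, **`tendsto_wPolynomialQuot_div`** (`δ^{−2}W_{G/G′}/V_{G/G′} →
  (W_{G/G′})₂(c)/(V_{G/G′})₀(c)`), **`div_eval_initForm_eq_add`** (THE `δ²`-COEFFICIENTS ADD: `W_β(c)/V_β(c) = W_{G′}(c)/V_{G′}(c) +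
  (W_{G/G′})₂(c)/(V_{G/G′})₀(c)` under `ord W = ord V + 2`), and **`tendsto_wPolynomial_div_div_add`** — (25) AS PRINTED in footnote 16's
  sense: `(W/V)/(W_{G′}/V_{G′} + W_{G/G′}/V_{G/G′}) → 1` as `δ → 0⁺` along `z_l = c_l δ^{β_l}`, `c_l > 0`.
* §9 (appended) **`initForm_wPolynomial_irVector`** (`in_β W = V_{G′}·(W_{G/G′})₂ + W_{G′}·V_{G/(G′∪P₁∪P₂)}` under `ord W = ord V + 2`) and
  **`initForm_wPolynomial_irVector_eq_add`** (`in_β W = V_{G′}·in_β W_{G/G′} + W_{G′}·in_β V_{G/G′}` when `W_{G/G′}` has a weight-2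
  monomial — (25) with every factor an initial form).
NOT CLAIMED: the other relations of (24) (`B_{j₁j₂}`, `Q̂_l` — untyped), (23), the circuit identity (26) and the printed circuit proof
of (25) (V3b's `Volkov2020/OnShellDenominatorCircuit` is the circuit model; the identification `S/V =` effective resistance is not in
the tree), App. C's nested-subgraph version of (25) («аналогичный процесс для цепи G/G′» iterated) and its `W`-chain relation, the
assembly «разность I(z) − I′(z) удовлетворяет условиям утверждения 1», anything about numerators, `I`, `I′` or a QED graph; that a given
QED graph satisfies (Hℓ), (Hγ), (HP₁), (HP₂), «W/V ≍ δ²» (evident per graph; no QED graph model in this vocabulary, as in the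
companions); the quotient GRAPH `G/G′` and the subgraph `G′` as edge lists in their own right (the matroid dictionary replaces them —
exactly as in `KirchhoffFactorization.lean` / `SecondSymanzikFactorization.lean`; a stdlib brute force on the 2-loop ladder of Fig. 5,
two 3-loop ladders, a crossed 3-loop graph and two further graphs, with `S_{G′}`, `S_{G/G′}` computed from the ACTUAL subgraph and
quotient graph, agrees with §6/§7 term by term — session folder `scratch/check25.py`, not shipped). presearch (g32): the two-level
graded piece of the separating-2-forest polynomial / (25) → none in the held corpus or galaxy beyond the source (`lit search --hybrid
"second Symanzik polynomial factorization subgraph quotient infrared asymptotic on-shell … W/V additivity Volkov"` → Henn–Plefka,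
Manoukian, Collins textbook pages, generic; `lit galaxy search "W_{G/G'}|infrared counterterm asymptotics|IR factorisation Symanzik"
--star all` → 0 hits; 2026-08-25) — cited to ЖЭТФ §5.3 for the statements and to Brown 2017 Prop. 2.2/2.4 (through the LIT seat's
file) and Oxley 2011 for the tools.
-/

noncomputable section

namespace Literature.MathematicalPhysics.QuantumFieldTheory.Volkov2016

open MvPolynomial Finset Filter Matroid
open scoped _root_.Topology Classical
open Literature.MathematicalPhysics.QuantumFieldTheory
open Literature.MathematicalPhysics.QuantumFieldTheory.Borinsky2020

/-! ## §1 Graded pieces of a polynomial along a real weight vector (the general term of App. A's grouping by powers of `δ`) -/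

section WeightPart

variable {n : ℕ}

/-- **The weight-`k` part of `R` along `β`**: the sum of the monomials `r` of `R` with `⟨r, β⟩ = k` — along `z_i = c_i δ^{β_i}`
these are the terms of `R(z(δ))` carrying exactly `δ^k` (App. A groups the terms of a polynomial by the value of the exponent
`(l_q − s_j)·r`; the top group is the initial form `initForm R β = weightPart R β (rayOrder R β)`). [cite: Volkov2016, §5.1 (19)–(20) and App. A (p.1185)] -/
def weightPart (R : MvPolynomial (Fin n) ℝ) (β : Fin n → ℝ) (k : ℝ) : MvPolynomial (Fin n) ℝ :=
  ∑ r ∈ R.support with linPair (castExp r) β = k, monomial r (R.coeff r)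

/-- The initial form is the weight part at the ray order (definitional). [cite: Volkov2016, App. A (p.1185)] -/
theorem initForm_eq_weightPart (R : MvPolynomial (Fin n) ℝ) (β : Fin n → ℝ) :
    initForm R β = weightPart R β (rayOrder R β) := rfl

/-- Coefficients of the weight part: `R`'s on the monomials of weight `k`, `0` elsewhere. [cite: Volkov2016, App. A (p.1185: the terms of a polynomial along a ray grouped by the value of the exponent) with §5.1 (19)–(20)] -/
theorem coeff_weightPart (R : MvPolynomial (Fin n) ℝ) (β : Fin n → ℝ) (k : ℝ) (s : Fin n →₀ ℕ) :
    coeff s (weightPart R β k) = if linPair (castExp s) β = k then coeff s R else 0 := by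
  unfold weightPart
  rw [coeff_sum]
  simp only [coeff_monomial]
  rw [Finset.sum_ite_eq']
  simp only [Finset.mem_filter, mem_support_iff]
  by_cases h : linPair (castExp s) β = k
  · by_cases h0 : coeff s R = 0
    · simp [h, h0]
    · simp [h, h0]
  · simp [h]

/-- The support of the weight part. [cite: Volkov2016, App. A (p.1185: the terms of a polynomial along a ray grouped by the value of the exponent) with §5.1 (19)–(20)] -/
theorem support_weightPart (R : MvPolynomial (Fin n) ℝ) (β : Fin n → ℝ) (k : ℝ) :
    (weightPart R β k).support = R.support.filter fun r => linPair (castExp r) β = k := by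
  ext s
  rw [mem_support_iff, coeff_weightPart, Finset.mem_filter, mem_support_iff]
  by_cases h : linPair (castExp s) β = k <;> simp [h]

/-- Every monomial of the weight-`k` part has weight `k`. [cite: Volkov2016, App. A (p.1185: the terms of a polynomial along a ray grouped by the value of the exponent) with §5.1 (19)–(20)] -/
theorem linPair_eq_of_mem_support_weightPart {R : MvPolynomial (Fin n) ℝ} {β : Fin n → ℝ} {k : ℝ} {s : Fin n →₀ ℕ}
    (hs : s ∈ (weightPart R β k).support) : linPair (castExp s) β = k := by
  rw [support_weightPart, Finset.mem_filter] at hs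
  exact hs.2

/-- The weight part is additive. [cite: Volkov2016, App. A (p.1185: the terms of a polynomial along a ray grouped by the value of the exponent) with §5.1 (19)–(20)] -/
theorem weightPart_add (R S : MvPolynomial (Fin n) ℝ) (β : Fin n → ℝ) (k : ℝ) :
    weightPart (R + S) β k = weightPart R β k + weightPart S β k := by
  ext s
  simp only [coeff_weightPart, coeff_add]
  split_ifs <;> simp

/-- The weight part commutes with negation. [cite: Volkov2016, App. A (p.1185: the terms of a polynomial along a ray grouped by the value of the exponent) with §5.1 (19)–(20)] -/
theorem weightPart_neg (R : MvPolynomial (Fin n) ℝ) (β : Fin n → ℝ) (k : ℝ) :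
    weightPart (-R) β k = -weightPart R β k := by
  ext s
  simp only [coeff_weightPart, coeff_neg]
  split_ifs <;> simp

/-- The weight part is subtractive. [cite: Volkov2016, App. A (p.1185: the terms of a polynomial along a ray grouped by the value of the exponent) with §5.1 (19)–(20)] -/
theorem weightPart_sub (R S : MvPolynomial (Fin n) ℝ) (β : Fin n → ℝ) (k : ℝ) :
    weightPart (R - S) β k = weightPart R β k - weightPart S β k := by
  rw [sub_eq_add_neg, weightPart_add, weightPart_neg, ← sub_eq_add_neg]

/-- The weight part of a finite sum. [cite: Volkov2016, App. A (p.1185: the terms of a polynomial along a ray grouped by the value of the exponent) with §5.1 (19)–(20)] -/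
theorem weightPart_sum {ι : Type*} (s : Finset ι) (f : ι → MvPolynomial (Fin n) ℝ) (β : Fin n → ℝ) (k : ℝ) :
    weightPart (∑ i ∈ s, f i) β k = ∑ i ∈ s, weightPart (f i) β k := by
  induction s using Finset.induction_on with
  | empty =>
    ext d
    simp [coeff_weightPart]
  | insert i s hi ih => rw [Finset.sum_insert hi, Finset.sum_insert hi, weightPart_add, ih]

/-- The weight part commutes with scalars. [cite: Volkov2016, App. A (p.1185: the terms of a polynomial along a ray grouped by the value of the exponent) with §5.1 (19)–(20)] -/
theorem weightPart_smul (c : ℝ) (R : MvPolynomial (Fin n) ℝ) (β : Fin n → ℝ) (k : ℝ) :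
    weightPart (c • R) β k = c • weightPart R β k := by
  ext s
  simp only [coeff_weightPart, coeff_smul, smul_eq_mul]
  split_ifs <;> simp

/-- A polynomial all of whose monomials have weight `k` is its own weight-`k` part. [cite: Volkov2016, App. A (p.1185: the terms of a polynomial along a ray grouped by the value of the exponent) with §5.1 (19)–(20)] -/
theorem weightPart_eq_self {R : MvPolynomial (Fin n) ℝ} {β : Fin n → ℝ} {k : ℝ}
    (h : ∀ d ∈ R.support, linPair (castExp d) β = k) : weightPart R β k = R := by
  ext s
  rw [coeff_weightPart]
  split_ifs with hs
  · rfl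
  · by_contra hne
    exact hs (h s (mem_support_iff.2 (Ne.symm hne)))

/-- A polynomial none of whose monomials has weight `k` has zero weight-`k` part. [cite: Volkov2016, App. A (p.1185: the terms of a polynomial along a ray grouped by the value of the exponent) with §5.1 (19)–(20)] -/
theorem weightPart_eq_zero {R : MvPolynomial (Fin n) ℝ} {β : Fin n → ℝ} {k : ℝ}
    (h : ∀ d ∈ R.support, linPair (castExp d) β ≠ k) : weightPart R β k = 0 := by
  ext s
  rw [coeff_weightPart, coeff_zero]
  split_ifs with hs
  · by_contra hne
    exact h s (mem_support_iff.2 hne) hs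
  · rfl

/-- Two weightings that select the same monomials of `R` give the same part. [cite: Volkov2016, App. A (p.1185: the terms of a polynomial along a ray grouped by the value of the exponent) with §5.1 (19)–(20)] -/
theorem weightPart_congr {R : MvPolynomial (Fin n) ℝ} {β₁ β₂ : Fin n → ℝ} {k₁ k₂ : ℝ}
    (h : ∀ d ∈ R.support, (linPair (castExp d) β₁ = k₁ ↔ linPair (castExp d) β₂ = k₂)) :
    weightPart R β₁ k₁ = weightPart R β₂ k₂ := by
  ext s
  rw [coeff_weightPart, coeff_weightPart]
  by_cases hs : s ∈ R.support
  · by_cases h1 : linPair (castExp s) β₁ = k₁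
    · rw [if_pos h1, if_pos ((h s hs).1 h1)]
    · rw [if_neg h1, if_neg fun h2 => h1 ((h s hs).2 h2)]
  · rw [notMem_support_iff.1 hs]
    split_ifs <;> rfl

/-- **Leading part plus remainder**: if every monomial of `L` has weight `k` and no monomial of `R − L` has, then the weight-`k`
part of `R` is `L` (the shape of Brown's «Ψ_G = Ψ_γ Ψ_{G/γ} + R^Ψ, deg_γ R > h_γ» read at `deg_γ = h_γ`). [cite: Brown2017, Prop. 2.2 (arXiv:1512.06409 §2.1)] -/
theorem weightPart_eq_of_remainder {R L : MvPolynomial (Fin n) ℝ} {β : Fin n → ℝ} {k : ℝ}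
    (hL : ∀ d ∈ L.support, linPair (castExp d) β = k) (hR : ∀ d ∈ (R - L).support, linPair (castExp d) β ≠ k) :
    weightPart R β k = L := by
  have h : R = L + (R - L) := by ring
  rw [h, weightPart_add, weightPart_eq_self hL, weightPart_eq_zero hR, add_zero]

/-- `castExp` is additive. [folklore] -/
private theorem castExp_add' (a b : Fin n →₀ ℕ) : castExp (a + b) = castExp a + castExp b := by
  funext i
  simp [castExp]

/-- `linPair` is additive in the exponent. [folklore] -/
private theorem linPair_add_left' (p q β : Fin n → ℝ) : linPair (p + q) β = linPair p β + linPair q β := by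
  simp only [linPair, Pi.add_apply, add_mul, Finset.sum_add_distrib]

/-- `linPair` is additive in the weight. [cite: Volkov2016, App. A (p.1185: the terms of a polynomial along a ray grouped by the value of the exponent) with §5.1 (19)–(20)] -/
theorem linPair_add_right (p β₁ β₂ : Fin n → ℝ) : linPair p (β₁ + β₂) = linPair p β₁ + linPair p β₂ := by
  simp only [linPair, Pi.add_apply, mul_add, Finset.sum_add_distrib]

/-- **Weight parts of a product by a homogeneous factor**: if every monomial of `p` has weight `i`, then the weight-`(i + k)`
part of `p·q` is `p` times the weight-`k` part of `q` (the graded Leibniz rule; App. A's grouping is multiplicative).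
[cite: Volkov2016, App. A (p.1185)] -/
theorem weightPart_mul_left {p q : MvPolynomial (Fin n) ℝ} {β : Fin n → ℝ} {i : ℝ}
    (hp : ∀ d ∈ p.support, linPair (castExp d) β = i) (k : ℝ) :
    weightPart (p * q) β (i + k) = p * weightPart q β k := by
  ext s
  rw [coeff_weightPart, coeff_mul, coeff_mul]
  by_cases hs : linPair (castExp s) β = i + k
  · rw [if_pos hs]
    refine Finset.sum_congr rfl fun x hx => ?_
    rw [coeff_weightPart]
    by_cases hpx : coeff x.1 p = 0
    · rw [hpx, zero_mul, zero_mul]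
    · have hxi : linPair (castExp x.1) β = i := hp x.1 (mem_support_iff.2 hpx)
      have hsum : x.1 + x.2 = s := Finset.HasAntidiagonal.mem_antidiagonal.1 hx
      have : linPair (castExp x.2) β = k := by
        have h2 := congrArg (fun d => linPair (castExp d) β) hsum
        simp only [castExp_add', linPair_add_left', hxi] at h2
        linarith
      rw [if_pos this]
  · rw [if_neg hs]
    symm
    refine Finset.sum_eq_zero fun x hx => ?_
    rw [coeff_weightPart]
    by_cases hpx : coeff x.1 p = 0
    · rw [hpx, zero_mul]
    · have hxi : linPair (castExp x.1) β = i := hp x.1 (mem_support_iff.2 hpx)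
      have hsum : x.1 + x.2 = s := Finset.HasAntidiagonal.mem_antidiagonal.1 hx
      rw [if_neg, mul_zero]
      intro h2k
      apply hs
      have h2 := congrArg (fun d => linPair (castExp d) β) hsum
      simp only [castExp_add', linPair_add_left', hxi, h2k] at h2
      exact h2.symm

/-- The same with the homogeneous factor on the right. [cite: Volkov2016, App. A (p.1185)] -/
theorem weightPart_mul_right {p q : MvPolynomial (Fin n) ℝ} {β : Fin n → ℝ} {i : ℝ}
    (hq : ∀ d ∈ q.support, linPair (castExp d) β = i) (k : ℝ) :
    weightPart (p * q) β (k + i) = weightPart p β k * q := by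
  rw [mul_comm, add_comm, weightPart_mul_left hq, mul_comm]

/-- Every monomial of `R` has weight `≥ rayOrder R β`. [cite: Volkov2016, §5.1 (19)–(20) with App. A (p.1185)] -/
theorem rayOrder_le_linPair {R : MvPolynomial (Fin n) ℝ} {d : Fin n →₀ ℕ} (hd : d ∈ R.support) (β : Fin n → ℝ) :
    rayOrder R β ≤ linPair (castExp d) β := by
  rw [rayOrder_eq_inf' (support_nonempty.1 ⟨d, hd⟩)]
  exact Finset.inf'_le _ hd

/-- A uniform lower bound on the weights of the monomials bounds the ray order from below. [cite: Volkov2016, §5.1 (19)–(20) with App. A (p.1185)] -/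
theorem le_rayOrder_of_forall_le {R : MvPolynomial (Fin n) ℝ} (hR : R ≠ 0) {β : Fin n → ℝ} {k : ℝ}
    (h : ∀ d ∈ R.support, k ≤ linPair (castExp d) β) : k ≤ rayOrder R β := by
  rw [rayOrder_eq_inf' hR]
  exact Finset.le_inf' _ _ h

/-- **The order is the least weight with a non-zero part**: if every monomial of `R` has weight `≥ k` and the weight-`k` part
does not vanish, then `rayOrder R β = k` and the initial form is the weight-`k` part. [cite: Volkov2016, App. A (p.1185)] -/
theorem rayOrder_eq_of_forall_le_of_weightPart_ne_zero {R : MvPolynomial (Fin n) ℝ} {β : Fin n → ℝ} {k : ℝ}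
    (h : ∀ d ∈ R.support, k ≤ linPair (castExp d) β) (hk : weightPart R β k ≠ 0) :
    rayOrder R β = k ∧ initForm R β = weightPart R β k := by
  obtain ⟨d, hd⟩ := support_nonempty.2 hk
  rw [support_weightPart, Finset.mem_filter] at hd
  have hR : R ≠ 0 := support_nonempty.1 ⟨d, hd.1⟩
  have hord : rayOrder R β = k :=
    le_antisymm (hd.2 ▸ rayOrder_le_linPair hd.1 β) (le_rayOrder_of_forall_le hR h)
  exact ⟨hord, by rw [initForm_eq_weightPart, hord]⟩

/-- Below the order every weight part vanishes. [cite: Volkov2016, §5.1 (19)–(20) with App. A (p.1185)] -/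
theorem weightPart_eq_zero_of_lt_rayOrder {R : MvPolynomial (Fin n) ℝ} {β : Fin n → ℝ} {k : ℝ} (hk : k < rayOrder R β) :
    weightPart R β k = 0 :=
  weightPart_eq_zero fun _ hd hdk => (hdk ▸ rayOrder_le_linPair hd β).not_gt hk

/-- `δ^s → 0` as `δ → 0⁺` for `s > 0`. [folklore] -/
private theorem tendsto_rpow_nhdsGT_zero' {s : ℝ} (hs : 0 < s) :
    Tendsto (fun δ : ℝ => δ ^ s) (𝓝[>] 0) (𝓝 0) := by
  have h := (Real.continuousAt_rpow_const 0 s (Or.inr hs.le)).tendsto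
  simp only [Real.zero_rpow hs.ne'] at h
  exact tendsto_nhdsWithin_of_tendsto_nhds h

/-- **The `δ^k`-coefficient along a ray**: if every monomial of `R` has weight `≥ k` along `β`, then
`δ^{−k} · R(c δ^β) → (weightPart R β k)(c)` as `δ → 0⁺` (for `k = rayOrder R β` this is `tendsto_rpow_neg_rayOrder_mul_eval`; for
larger admissible `k` the limit is the next group of App. A, possibly zero). [cite: Volkov2016, §5.1 (19) and App. A (p.1185)] -/
theorem tendsto_rpow_neg_mul_eval_weightPart (R : MvPolynomial (Fin n) ℝ) (β c : Fin n → ℝ) {k : ℝ}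
    (h : ∀ d ∈ R.support, k ≤ linPair (castExp d) β) :
    Tendsto (fun δ : ℝ => δ ^ (-k) * eval (rayPath c β δ) R) (𝓝[>] 0) (𝓝 (eval c (weightPart R β k))) := by
  have hev : (fun δ : ℝ => δ ^ (-k) * eval (rayPath c β δ) R) =ᶠ[𝓝[>] 0]
      fun δ => ∑ r ∈ R.support, R.coeff r * (∏ i, c i ^ r i) * δ ^ (linPair (castExp r) β - k) := by
    filter_upwards [self_mem_nhdsWithin] with δ (hδ : 0 < δ)
    rw [show rayPath c β δ = fun i => c i * δ ^ β i from rfl, eval_rayPath R β c hδ, Finset.mul_sum]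
    refine Finset.sum_congr rfl fun r _ => ?_
    rw [sub_eq_add_neg, Real.rpow_add hδ]
    ring
  refine (tendsto_congr' hev).2 ?_
  have heval : eval c (weightPart R β k) = ∑ r ∈ R.support with linPair (castExp r) β = k, R.coeff r * ∏ i, c i ^ r i := by
    rw [eval_eq', support_weightPart]
    exact Finset.sum_congr rfl fun r hr => by
      rw [coeff_weightPart, if_pos (Finset.mem_filter.1 hr).2]
  rw [heval, Finset.sum_filter]
  refine tendsto_finsetSum _ fun r hr => ?_
  by_cases hr' : linPair (castExp r) β = k
  · rw [if_pos hr']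
    have hfun : (fun δ : ℝ => R.coeff r * (∏ i, c i ^ r i) * δ ^ (linPair (castExp r) β - k))
        = fun _ => R.coeff r * ∏ i, c i ^ r i := by
      funext δ; rw [hr', sub_self, Real.rpow_zero, mul_one]
    rw [hfun]
    exact tendsto_const_nhds
  · rw [if_neg hr']
    have hlt : 0 < linPair (castExp r) β - k := by
      rcases (h r hr).lt_or_eq with hlt | heq
      · linarith
      · exact absurd heq.symm hr'
    have := (tendsto_rpow_nhdsGT_zero' hlt).const_mul (R.coeff r * ∏ i, c i ^ r i)
    simpa using this

/-- **A homogeneous polynomial scales exactly**: if every monomial of `R` has weight `k`, then `R(c δ^β) = δ^k R(c)` for `δ > 0`.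
[cite: Volkov2016, §5.1 (19)] -/
theorem eval_rayPath_of_forall_eq (R : MvPolynomial (Fin n) ℝ) (β c : Fin n → ℝ) {k : ℝ}
    (h : ∀ d ∈ R.support, linPair (castExp d) β = k) {δ : ℝ} (hδ : 0 < δ) :
    eval (rayPath c β δ) R = δ ^ k * eval c R := by
  rw [show rayPath c β δ = fun i => c i * δ ^ β i from rfl, eval_rayPath R β c hδ, eval_eq', Finset.mul_sum]
  refine Finset.sum_congr rfl fun r hr => ?_
  rw [h r hr]
  ring

end WeightPart

/-! ## §2 Two-level weights in degree form: `⟨d, 𝟙_γ + 𝟙_A⟩ = deg_γ x^d + deg_A x^d` -/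

section Degrees

variable {N : ℕ}

/-- `⟨d, 𝟙_S⟩ = deg_S x^d := Σ_{e∈S} d_e` (the LIT seat's `γ`-degree, read as a ray weight). [cite: Brown2017, Prop. 2.2 (proof: "the degree … in the variables α_e, e ∈ E_γ")] -/
theorem linPair_castExp_setIndicator (d : Fin N →₀ ℕ) (S : Finset (Fin N)) :
    linPair (castExp d) (setIndicator S) = ((∑ e ∈ S, d e : ℕ) : ℝ) := by
  unfold linPair castExp setIndicator
  rw [Nat.cast_sum]
  simp only [mul_ite, mul_one, mul_zero]
  rw [Finset.sum_ite_mem, Finset.univ_inter]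

/-- Along the two-level vector `𝟙_γ + 𝟙_A` (Volkov's IR vector for `A = γ ∪ P₁ ∪ P₂`: `2` on `γ`, `1` on `A ∖ γ`, `0` elsewhere)
the weight of `x^d` is `deg_γ x^d + deg_A x^d`. [cite: Volkov2016, §5.2 p.1175 (PDF p.12 L81–L85) with §5.1 (19)–(20)] -/
theorem linPair_castExp_twoLevel (d : Fin N →₀ ℕ) (γ A : Finset (Fin N)) :
    linPair (castExp d) (fun e => setIndicator γ e + setIndicator A e) = ((∑ e ∈ γ, d e + ∑ e ∈ A, d e : ℕ) : ℝ) := by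
  have : (fun e => setIndicator γ e + setIndicator A e) = setIndicator γ + setIndicator A := rfl
  rw [this, linPair_add_right, linPair_castExp_setIndicator, linPair_castExp_setIndicator, Nat.cast_add]

/-- **The IR vector of §5.2** for the subgraph `G′` with lines `γ` and electron lines `Pe`: `β = 𝟙_γ + 𝟙_{γ ∪ Pe}` — «β_j = 2 для
линий из G′, β_j = 1 для линий из P₁ и P₂, β_j = 0 для остальных линий» (`P₁ ∪ P₂ = Pe ∖ γ`). Written as the companion
`OneTreePolynomialQuotientFactorization`'s `fun e => setIndicator γ e + setIndicator (γ ∪ P) e` (`irVector_eq`, definitional).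
[cite: Volkov2016, §5.2 p.1175 (PDF p.12 L81–L85)] -/
def irVector (γ Pe : Finset (Fin N)) : Fin N → ℝ := fun e => setIndicator γ e + setIndicator (γ ∪ Pe) e

/-- `irVector γ Pe` is the companion's two-level lambda (definitional). [cite: Volkov2016, §5.2 p.1175 (PDF p.12 L81–L85)] -/
theorem irVector_eq (γ Pe : Finset (Fin N)) : irVector γ Pe = fun e => setIndicator γ e + setIndicator (γ ∪ Pe) e := rfl

/-- The weight of `x^d` along the IR vector is `deg_γ x^d + deg_{γ∪Pe} x^d`. [cite: Volkov2016, §5.2 p.1175 (PDF p.12 L81–L85) with §5.1 (19)–(20)] -/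
theorem linPair_castExp_irVector (d : Fin N →₀ ℕ) (γ Pe : Finset (Fin N)) :
    linPair (castExp d) (irVector γ Pe) = ((∑ e ∈ γ, d e + ∑ e ∈ γ ∪ Pe, d e : ℕ) : ℝ) :=
  linPair_castExp_twoLevel d γ (γ ∪ Pe)

/-- The exponent vector of a square-free monomial `Π_{e∈S} x_e`. [folklore] -/
private theorem prod_X_eq_monomial_sum (S : Finset (Fin N)) :
    ∏ e ∈ S, (X e : MvPolynomial (Fin N) ℝ) = monomial (∑ e' ∈ S, Finsupp.single e' 1) 1 := by
  induction S using Finset.induction_on with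
  | empty => simp
  | insert e S he ih =>
    rw [Finset.prod_insert he, Finset.sum_insert he, ih, ← pow_one (X e), X_pow_eq_monomial,
      monomial_mul, one_mul]

/-- `Σ_{e∈S} (𝟙_T)_e = |S ∩ T|`. [folklore] -/
private theorem sum_sumSingle_apply (S T : Finset (Fin N)) :
    ∑ e ∈ S, (∑ e' ∈ T, Finsupp.single e' (1 : ℕ) : Fin N →₀ ℕ) e = (S ∩ T).card := by
  have happ : ∀ e, (∑ e' ∈ T, Finsupp.single e' (1 : ℕ) : Fin N →₀ ℕ) e = if e ∈ T then 1 else 0 := fun e => by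
    rw [Finsupp.coe_finsetSum, Finset.sum_apply]
    simp [Finsupp.single_apply, eq_comm]
  simp only [happ]
  rw [Finset.sum_boole, Finset.filter_mem_eq_inter, Nat.cast_id]

/-- **The `S`-degree of a square-free monomial**: every monomial of `Π_{e∈T} x_e` (there is one) has `deg_S = |S ∩ T|`. [folklore] -/
private theorem sdeg_of_mem_support_prod_X (S T : Finset (Fin N)) {d : Fin N →₀ ℕ}
    (hd : d ∈ (∏ e ∈ T, (X e : MvPolynomial (Fin N) ℝ)).support) : ∑ e ∈ S, d e = (S ∩ T).card := by
  rw [prod_X_eq_monomial_sum] at hd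
  rw [Finset.mem_singleton.1 (support_monomial_subset hd), sum_sumSingle_apply]

/-- The only monomial of `x_e` has `deg_S = [e ∈ S]`. [folklore] -/
private theorem sdeg_of_mem_support_X (S : Finset (Fin N)) (e : Fin N) {d : Fin N →₀ ℕ}
    (hd : d ∈ (X e : MvPolynomial (Fin N) ℝ).support) : ∑ e' ∈ S, d e' = if e ∈ S then 1 else 0 := by
  rw [support_X, Finset.mem_singleton] at hd
  subst hd
  simp only [Finsupp.single_apply]
  rw [Finset.sum_ite_eq]

/-- Monomials of a product are sums of monomials of the factors. [folklore] -/
private theorem exists_add_of_mem_support_mul {p q : MvPolynomial (Fin N) ℝ} {d : Fin N →₀ ℕ} (hd : d ∈ (p * q).support) :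
    ∃ a ∈ p.support, ∃ b ∈ q.support, a + b = d := by
  obtain ⟨a, ha, b, hb, rfl⟩ := Finset.mem_add.1 (support_mul p q hd)
  exact ⟨a, ha, b, hb, rfl⟩

/-- **The weight-`0` part along `𝟙_S` of a square-free monomial**: `Π_{e∈T} x_e` survives iff `T` avoids `S`. [folklore] -/
private theorem weightPart_prod_X_setIndicator_zero (S T : Finset (Fin N)) :
    weightPart (∏ e ∈ T, (X e : MvPolynomial (Fin N) ℝ)) (setIndicator S) 0 =
      if Disjoint S T then ∏ e ∈ T, (X e : MvPolynomial (Fin N) ℝ) else 0 := by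
  split_ifs with h
  · refine weightPart_eq_self fun d hd => ?_
    rw [linPair_castExp_setIndicator, sdeg_of_mem_support_prod_X S T hd, Finset.disjoint_iff_inter_eq_empty.1 h,
      Finset.card_empty, Nat.cast_zero]
  · refine weightPart_eq_zero fun d hd h0 => h ?_
    rw [linPair_castExp_setIndicator, sdeg_of_mem_support_prod_X S T hd, Nat.cast_eq_zero, Finset.card_eq_zero] at h0
    exact Finset.disjoint_iff_inter_eq_empty.2 h0

end Degrees

/-! ## §3 Volkov's `S` is the massless second Symanzik polynomial with a unit scalar momentum entering at `u` and leaving at `w` -/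

section UnitMomentum

variable {N V : ℕ}

/-- The kinematics behind Volkov's `S`: a unit (scalar) momentum enters at the vertex `u` of the incoming external electron
line and leaves at the vertex `w` of the outgoing one, so that the flow across a 2-tree is `±1` if it separates `u` from `w`
and `0` otherwise («2-деревья, для которых вершины, инцидентные электронным внешним линиям G, лежат в разных компонентах
связности»). [cite: Volkov2016, §5.1 p.1174 (definition of S); Brown2017, Def. 1.3 eq. (phidefn) (the flow q^{T_1})] -/
def unitMomentum (u w : Fin (V + 1)) : Fin (V + 1) → ℝ :=
  fun v => (if v = u then 1 else 0) - (if v = w then 1 else 0)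

/-- The unit momentum is conserved. [cite: Brown2017, §1.2 ("by momentum conservation")] -/
theorem sum_unitMomentum (u w : Fin (V + 1)) : ∑ v, unitMomentum u w v = 0 := by
  simp [unitMomentum, Finset.sum_sub_distrib]

/-- Only `u` and `w` carry momentum. [folklore] -/
private theorem eq_or_eq_of_unitMomentum_ne_zero {u w v : Fin (V + 1)} (h : unitMomentum u w v ≠ 0) : v = u ∨ v = w := by
  by_contra hc
  push Not at hc
  simp [unitMomentum, hc.1, hc.2] at h

/-- The momentum collected by a vertex set `C`: `[u ∈ C] − [w ∈ C]`. [folklore] -/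
private theorem sum_unitMomentum_eq (u w : Fin (V + 1)) (C : Finset (Fin (V + 1))) :
    ∑ v ∈ C, unitMomentum u w v = (if u ∈ C then 1 else 0) - (if w ∈ C then 1 else 0) := by
  simp only [unitMomentum, Finset.sum_sub_distrib, Finset.sum_ite_eq']

/-- **The squared flow is the separation indicator**: `‖Σ_{v∈C} p_v‖² = 0` if `C` contains both or neither of `u`, `w`, and
`1` otherwise. [cite: Volkov2016, §5.1 p.1174 (definition of S); Brown2017, Def. 1.3] -/
theorem norm_sq_sum_unitMomentum (u w : Fin (V + 1)) (C : Finset (Fin (V + 1))) :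
    ‖∑ v ∈ C, unitMomentum u w v‖ ^ 2 = if (u ∈ C ↔ w ∈ C) then 0 else 1 := by
  rw [sum_unitMomentum_eq, Real.norm_eq_abs, sq_abs]
  by_cases hu : u ∈ C <;> by_cases hw : w ∈ C <;> simp [hu, hw]

variable (E : Fin N → Fin (V + 1) × Fin (V + 1))

/-- In a graph with exactly two components, two non-joined vertices represent the components (as
`IsSpanningTwoForest.reachable_iff_not_reachable`, for an arbitrary edge set). [cite: Brown2017, Def. 1.2 (k = 2)] -/
theorem reachable_iff_not_reachable_of_natCard_eq_two {X : Finset (Fin N)}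
    (h2 : Nat.card (edgeGraph E X).ConnectedComponent = 2) {a b : Fin (V + 1)} (hab : ¬ (edgeGraph E X).Reachable a b)
    (x : Fin (V + 1)) : (edgeGraph E X).Reachable a x ↔ ¬ (edgeGraph E X).Reachable b x := by
  rw [Nat.card_eq_two_iff' ((edgeGraph E X).connectedComponentMk a)] at h2
  obtain ⟨y, -, huniq⟩ := h2
  have hb : (edgeGraph E X).connectedComponentMk b = y :=
    huniq _ fun h => hab (SimpleGraph.ConnectedComponent.eq.1 h).symm
  constructor
  · intro hax hbx
    exact hab (hax.trans hbx.symm)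
  · intro hbx
    by_contra hax
    have hx : (edgeGraph E X).connectedComponentMk x = y :=
      huniq _ fun h => hax (SimpleGraph.ConnectedComponent.eq.1 h).symm
    exact hbx (SimpleGraph.ConnectedComponent.eq.1 (hb.trans hx.symm))

/-- In a graph with exactly two components, a base vertex `x₀` sees `u` and `w` alike iff `u ~ w`. [cite: Brown2017, Def. 1.2 (k = 2)] -/
theorem reachable_iff_reachable_iff_of_natCard_eq_two {X : Finset (Fin N)}
    (h2 : Nat.card (edgeGraph E X).ConnectedComponent = 2) (x₀ u w : Fin (V + 1)) :
    ((edgeGraph E X).Reachable x₀ u ↔ (edgeGraph E X).Reachable x₀ w) ↔ (edgeGraph E X).Reachable u w := by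
  constructor
  · intro h
    by_contra huw
    have h1 := reachable_iff_not_reachable_of_natCard_eq_two E h2 huw x₀
    have h' : (edgeGraph E X).Reachable u x₀ ↔ (edgeGraph E X).Reachable w x₀ :=
      ⟨fun h3 => (h.1 h3.symm).symm, fun h3 => (h.2 h3.symm).symm⟩
    exact iff_not_self (h'.symm.trans h1)
  · intro huw
    exact ⟨fun h => h.trans huw, fun h => h.trans huw.symm⟩

/-- A spanning 2-forest separates `u` from `w` iff the root component contains exactly one of them. [cite: Brown2017, Def. 1.2–1.3] -/
theorem norm_sq_momentumFlow_unitMomentum {F : Finset (Fin N)} (hF : IsSpanningTwoForest E F) (u w : Fin (V + 1)) :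
    ‖momentumFlow E F (unitMomentum u w)‖ ^ 2 = if (edgeGraph E F).Reachable u w then 0 else 1 := by
  unfold momentumFlow
  rw [norm_sq_sum_unitMomentum]
  simp only [Finset.mem_filter, Finset.mem_univ, true_and]
  have key := reachable_iff_reachable_iff_of_natCard_eq_two E hF.natCard_connectedComponent 0 u w
  by_cases h : (edgeGraph E F).Reachable u w
  · rw [if_pos (key.2 h), if_pos h]
  · rw [if_neg (fun hh => h (key.1 hh)), if_neg h]

/-- **Volkov's `S` = the massless second Symanzik polynomial `Φ_G` for a unit scalar momentum through `u → w`**: both are the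
sum over the spanning 2-forests separating `u` from `w` of their chord monomials (Volkov: «S — сумма по всем 2-деревьям, для
которых вершины, инцидентные электронным внешним линиям G, лежат в разных компонентах связности, произведений z_l по хордам»;
Borinsky/Brown: `Φ_G = Σ_{T₂} ‖p(T₂)‖² Π_{e∉T₂} x_e`, here `‖p(T₂)‖² ∈ {0, 1}`). This identification puts Brown's factorisation
theorems (the LIT seat's `SecondSymanzikFactorization.lean`) at the service of §5.3. [cite: Volkov2016, §5.1 p.1174 (definition of S); Borinsky2020, §7.1 eq. (PsiPhi_slow); Brown2017, Def. 1.3] -/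
theorem twoTreePolynomial_eq_secondSymanzikPolynomial (u w : Fin (V + 1)) :
    twoTreePolynomial ℝ E u w = secondSymanzikPolynomial E (unitMomentum u w) (fun _ => (0 : ℝ)) := by
  unfold twoTreePolynomial secondSymanzikPolynomial
  have h0 : (∑ e, ((fun _ => (0 : ℝ)) e) ^ 2 • (X e : MvPolynomial (Fin N) ℝ)) = 0 := by simp
  rw [h0, mul_zero, add_zero]
  have hset : univ.filter (IsSepTwoTree E u w) =
      (univ.filter (IsSpanningTwoForest E)).filter (fun F => ¬ (edgeGraph E F).Reachable u w) := by
    ext F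
    simp only [Finset.mem_filter, Finset.mem_univ, true_and, IsSepTwoTree, isTwoTree_iff_isSpanningTwoForest]
  rw [hset, Finset.sum_filter]
  refine Finset.sum_congr rfl fun F hF => ?_
  rw [norm_sq_momentumFlow_unitMomentum E (Finset.mem_filter.1 hF).2 u w]
  by_cases h : (edgeGraph E F).Reachable u w
  · simp [h]
  · simp [h]

end UnitMomentum

/-! ## §4 The blocks of `G′` and `G/G′`: Volkov's `S_{G′}`, `W_{G′}`, `S_{G/G′}`, `W_{G/G′}` («строятся по правилам, аналогичным описанным выше для построения … W, V»), in the tree's matroid dictionary -/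

section Blocks

variable {N V : ℕ} (E : Fin N → Fin (V + 1) × Fin (V + 1))

/-- **`S_{G′}`** — the separating-2-tree polynomial of the SUBGRAPH `G′` spanned by the line set `γ`, whose external electron
lines attach at the vertices `a` (where the electron path enters `G′`) and `b` (where it leaves): the sum over the 2-trees
`F′` of `G′` (independent `F′ ⊆ γ` one line short of a spanning tree of `G′`: `rk F′ = |F′| = rk γ − 1`) NOT joining `a` to `b`,
of `Π_{l ∈ γ∖F′} z_l` — `S` of §5.1 built for `G′` («строятся по правилам, аналогичным описанным выше»). Dictionary: it is the
LIT seat's `secondSymanzikSub E γ (unitMomentum a b) 0 a` (`twoTreePolynomialSub_eq_secondSymanzikSub`).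
[cite: Volkov2016, §5.1 p.1174 (definition of S) and §5.3 p.1177 (PDF p.14 L21–L31); Brown2017, Prop. 2.4 (Φ_γ)] -/
def twoTreePolynomialSub (γ : Finset (Fin N)) (a b : Fin (V + 1)) : MvPolynomial (Fin N) ℝ :=
  ∑ F' ∈ γ.powerset.filter (fun F' : Finset (Fin N) =>
      edgeRank E F' = F'.card ∧ F'.card + 1 = edgeRank E γ ∧ ¬ (edgeGraph E F').Reachable a b),
    ∏ e ∈ γ \ F', (X e : MvPolynomial (Fin N) ℝ)

/-- **`S_{G/G′}`** — the separating-2-tree polynomial of the QUOTIENT `G/G′` («граф, получающийся из G заменой подграфа G′ на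
вершину», footnote 17), in the matroid dictionary of `quotientPolynomial` / the LIT seat's `secondSymanzikQuot`: a 2-tree of
`G/G′` is an independent set `T′ ⊆ E ∖ γ` of the contraction `M(G)/γ` with `|T′| = |V_{G/G′}| − 2`; its two components are
those of the graph `γ ∪ T′` on the vertices of `G`, so it separates the external electron vertices iff `u ≁_{γ ∪ T′} w`; its
chord monomial is `Π_{l ∈ (E∖γ)∖T′} z_l`. Dictionary: `= secondSymanzikQuot E γ (unitMomentum u w) 0`
(`twoTreePolynomialQuot_eq_secondSymanzikQuot`). [cite: Volkov2016, §5.1 p.1174 (definition of S), §5.3 p.1177 footnote 17 (PDF p.14 L67–L71) and (PDF p.14 L21–L31); Brown2017, §1.4 (the quotient G/γ) and Prop. 2.2 (Φ_{G/γ}); Oxley2011, §3.1 Prop. 3.1.7] -/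
def twoTreePolynomialQuot (γ : Finset (Fin N)) (u w : Fin (V + 1)) : MvPolynomial (Fin N) ℝ :=
  ∑ T' ∈ γᶜ.powerset.filter (fun T' : Finset (Fin N) =>
      ((cycleMatroid E) ／ (↑γ : Set (Fin N))).Indep (↑T' : Set (Fin N)) ∧ T'.card + 2 + edgeRank E γ = V + 1 ∧
        ¬ (edgeGraph E (γ ∪ T')).Reachable u w),
    ∏ e ∈ γᶜ \ T', (X e : MvPolynomial (Fin N) ℝ)

/-- **`W_{G′} = S_{G′} − V_{G′}·z_{e′}`**, with `z_{e′}` the sum of `z_l` over the electron lines INSIDE `G′` (`Pe ∩ γ`) and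
`V_{G′} = subgraphPolynomial E γ` (the companion's). [cite: Volkov2016, §5.1 p.1174 (W = S − V z_e) and §5.3 p.1177 (PDF p.14 L21–L31)] -/
def wPolynomialSub (γ : Finset (Fin N)) (a b : Fin (V + 1)) (Pe : Finset (Fin N)) : MvPolynomial (Fin N) ℝ :=
  twoTreePolynomialSub E γ a b - subgraphPolynomial E γ * lineSum ℝ (Pe ∩ γ)

/-- **`W_{G/G′} = S_{G/G′} − V_{G/G′}·z_{e″}`**, with `z_{e″}` the sum of `z_l` over the electron lines of `G/G′` (`Pe ∖ γ`,
the lines of `P₁ ∪ P₂`) and `V_{G/G′} = quotientPolynomial E γ` (the companion's). [cite: Volkov2016, §5.1 p.1174 (W = S − V z_e), §5.3 p.1177 (PDF p.14 L21–L31) and footnote 17] -/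
def wPolynomialQuot (γ : Finset (Fin N)) (u w : Fin (V + 1)) (Pe : Finset (Fin N)) : MvPolynomial (Fin N) ℝ :=
  twoTreePolynomialQuot E γ u w - quotientPolynomial E γ * lineSum ℝ (Pe \ γ)

/-- `V_{G′}`: the companion's `subgraphPolynomial` IS the LIT seat's `kirchhoffSub` (same formula). [cite: Brown2017, Prop. 2.2] -/
theorem subgraphPolynomial_eq_kirchhoffSub (γ : Finset (Fin N)) : subgraphPolynomial E γ = kirchhoffSub E γ := rfl

/-- `V_{G/G′}`: the companion's `quotientPolynomial` IS the LIT seat's `kirchhoffQuot` (same formula). [cite: Brown2017, Prop. 2.2] -/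
theorem quotientPolynomial_eq_kirchhoffQuot (γ : Finset (Fin N)) : quotientPolynomial E γ = kirchhoffQuot E γ := rfl

/-- **`S_{G′} = Ξ_γ` for the unit momentum `a → b`, read from `a`** (Brown's second Symanzik polynomial of the edge subgraph with
its own kinematics; massless). [cite: Volkov2016, §5.3 p.1177 (PDF p.14 L21–L31); Brown2017, Prop. 2.4 (Φ_γ)] -/
theorem twoTreePolynomialSub_eq_secondSymanzikSub (γ : Finset (Fin N)) (a b : Fin (V + 1)) :
    twoTreePolynomialSub E γ a b = secondSymanzikSub E γ (unitMomentum a b) (fun _ => (0 : ℝ)) a := by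
  unfold twoTreePolynomialSub secondSymanzikSub
  have h0 : (∑ e ∈ γ, ((fun _ => (0 : ℝ)) e) ^ 2 • (X e : MvPolynomial (Fin N) ℝ)) = 0 := by simp
  rw [h0, mul_zero, add_zero]
  have hset : γ.powerset.filter (fun F' : Finset (Fin N) =>
      edgeRank E F' = F'.card ∧ F'.card + 1 = edgeRank E γ ∧ ¬ (edgeGraph E F').Reachable a b) =
      (γ.powerset.filter (fun F' : Finset (Fin N) => edgeRank E F' = F'.card ∧ F'.card + 1 = edgeRank E γ)).filter
        (fun F' => ¬ (edgeGraph E F').Reachable a b) := by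
    ext F'
    simp only [Finset.mem_filter, and_assoc]
  rw [hset, Finset.sum_filter]
  refine Finset.sum_congr rfl fun F' _ => ?_
  rw [norm_sq_sum_unitMomentum]
  simp only [Finset.mem_filter, Finset.mem_univ, true_and, SimpleGraph.Reachable.refl, true_iff]
  by_cases h : (edgeGraph E F').Reachable a b
  · simp [h]
  · simp [h]

/-- **The rank of `γ ∪ T′` for `T′` independent in `M(G)/γ`** is `rk γ + |T′|` (each line of `T′` joins two components of
what precedes it). [cite: Oxley2011, §3.1 Prop. 3.1.7 / eq. (3.1.6)] -/
theorem edgeRank_union_of_contract_indep {γ T' : Finset (Fin N)}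
    (hT' : ((cycleMatroid E) ／ (↑γ : Set (Fin N))).Indep (↑T' : Set (Fin N))) :
    edgeRank E (γ ∪ T') = edgeRank E γ + T'.card := by
  obtain ⟨F, hF⟩ := exists_isBasis_cycleMatroid E γ
  have hFγ := (isBasis_cycleMatroid_iff E F γ).1 hF
  have hdisjγ : Disjoint (γ : Set (Fin N)) (T' : Set (Fin N)) := by
    have h := hT'.subset_ground
    rw [contract_ground, cycleMatroid_ground] at h
    exact Set.disjoint_left.2 fun e he heT => (h heT).2 he
  have hind := hT'
  rw [hF.contract_indep_iff_of_disjoint hdisjγ, ← Finset.coe_union, indep_cycleMatroid_iff_edgeRank] at hind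
  have hdisj : Disjoint T' F := by
    rw [← Finset.disjoint_coe]
    exact (hdisjγ.mono_left (Finset.coe_subset.2 hFγ.1)).symm
  rw [← edgeRank_union_eq_of_isBasis E hF T', Finset.union_comm, hind, Finset.card_union_of_disjoint hdisj, hFγ.2.2,
    add_comm]

/-- A 2-tree `T′` of `G/G′` spans, together with `γ`, exactly two components on the vertices of `G`. [cite: Brown2017, §1.4 (G/γ) and Def. 1.2] -/
theorem natCard_connectedComponent_union_eq_two {γ T' : Finset (Fin N)}
    (hT' : ((cycleMatroid E) ／ (↑γ : Set (Fin N))).Indep (↑T' : Set (Fin N))) (hcard : T'.card + 2 + edgeRank E γ = V + 1) :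
    Nat.card (edgeGraph E (γ ∪ T')).ConnectedComponent = 2 := by
  have h := edgeRank_add_natCard_connectedComponent E (γ ∪ T')
  rw [edgeRank_union_of_contract_indep E hT'] at h
  omega

/-- **`S_{G/G′} = Ξ_{G/γ}` for the unit momentum `u → w`** (massless). [cite: Volkov2016, §5.3 p.1177 footnote 17 (PDF p.14 L67–L71); Brown2017, Prop. 2.2 (Φ_{G/γ}); Borinsky2020, §7.1] -/
theorem twoTreePolynomialQuot_eq_secondSymanzikQuot (γ : Finset (Fin N)) (u w : Fin (V + 1)) :
    twoTreePolynomialQuot E γ u w = secondSymanzikQuot E γ (unitMomentum u w) (fun _ => (0 : ℝ)) := by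
  unfold twoTreePolynomialQuot secondSymanzikQuot
  have h0 : (∑ e ∈ γᶜ, ((fun _ => (0 : ℝ)) e) ^ 2 • (X e : MvPolynomial (Fin N) ℝ)) = 0 := by simp
  rw [h0, mul_zero, add_zero]
  have hset : γᶜ.powerset.filter (fun T' : Finset (Fin N) =>
      ((cycleMatroid E) ／ (↑γ : Set (Fin N))).Indep (↑T' : Set (Fin N)) ∧ T'.card + 2 + edgeRank E γ = V + 1 ∧
        ¬ (edgeGraph E (γ ∪ T')).Reachable u w) =
      (γᶜ.powerset.filter (fun T' : Finset (Fin N) =>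
        ((cycleMatroid E) ／ (↑γ : Set (Fin N))).Indep (↑T' : Set (Fin N)) ∧ T'.card + 2 + edgeRank E γ = V + 1)).filter
        (fun T' => ¬ (edgeGraph E (γ ∪ T')).Reachable u w) := by
    ext T'
    simp only [Finset.mem_filter, and_assoc]
  rw [hset, Finset.sum_filter]
  refine Finset.sum_congr rfl fun T' hT' => ?_
  obtain ⟨-, hind, hcard⟩ := Finset.mem_filter.1 hT'
  unfold momentumFlow
  rw [norm_sq_sum_unitMomentum]
  simp only [Finset.mem_filter, Finset.mem_univ, true_and]
  have key := reachable_iff_reachable_iff_of_natCard_eq_two E (natCard_connectedComponent_union_eq_two E hind hcard) 0 u w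
  by_cases h : (edgeGraph E (γ ∪ T')).Reachable u w
  · rw [if_pos (key.2 h)]
    simp [h]
  · rw [if_neg (fun hh => h (key.1 hh))]
    simp [h]

end Blocks

/-! ## §5 From `G′ ∪ P₁ ∪ P₂` to `G′`: the two conversion lemmas

With `A = γ ∪ Pe` (the lines of `G′ ∪ P₁ ∪ P₂`) and `P = Pe ∖ γ` (the lines of `P₁ ∪ P₂`): (a) the 2-trees of the subgraph `A`
CONTAINING `P` and separating `u` from `w` are exactly `F′ ∪ P` for the 2-trees `F′` of `G′` separating `a` from `b`; (b) the
spanning trees of `G/A` are exactly the spanning trees of `G/G′` containing `P`, minus `P`. Hypotheses (edge-list form of §5.2's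
setting, flagged): `ℓ(A) = ℓ(γ)` in rank form `rk A = rk γ + |P|` («P₁, P₂ и любое 1-дерево G′» is a 1-tree: the electron path adds
no cycle to `G′`), `a ~_γ b` (`G′` is connected and contains the vertices `a`, `b` where the electron path enters and leaves it),
`u ~_P a` and `b ~_P w` (`P₁` joins `u` to `a`, `P₂` joins `b` to `w`). -/

section Conversion

variable {N V : ℕ} (E : Fin N → Fin (V + 1) × Fin (V + 1))
variable {γ Pe : Finset (Fin N)} {u w a b : Fin (V + 1)}

/-- `γ ∪ (Pe ∖ γ) = γ ∪ Pe`. Plumbing. [folklore] -/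
private theorem union_sdiff_eq (γ Pe : Finset (Fin N)) : γ ∪ (Pe \ γ) = γ ∪ Pe :=
  Finset.union_sdiff_self_eq_union

/-- **A forest of `G′` together with `P` is a forest** when `P` closes no cycle with `G′` (`rk(γ ∪ P) = rk γ + |P|`): extend the
forest to a 1-tree `F` of `G′`; `F ∪ P` has rank `rk(γ ∪ P) = |F| + |P|`. [cite: Volkov2016, §5.2 p.1175 (PDF p.12 L86–L88: «дерево состоит из P₁, P₂ и любого 1-дерева G′»); Oxley2011, §1.4 (closure)] -/
theorem edgeRank_union_sdiff_eq_card (hrk : edgeRank E (γ ∪ Pe) = edgeRank E γ + (Pe \ γ).card) {F' : Finset (Fin N)}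
    (hF'γ : F' ⊆ γ) (hF' : edgeRank E F' = F'.card) : edgeRank E (F' ∪ (Pe \ γ)) = (F' ∪ (Pe \ γ)).card := by
  have hind : (cycleMatroid E).Indep (F' : Set (Fin N)) := (indep_cycleMatroid_iff_edgeRank E F').2 hF'
  obtain ⟨F₀, hF₀, hF'F₀⟩ := hind.subset_isBasis_of_subset (Finset.coe_subset.2 hF'γ)
  obtain ⟨F, rfl⟩ : ∃ F : Finset (Fin N), (F : Set (Fin N)) = F₀ := ⟨(Set.toFinite F₀).toFinset, by simp⟩
  have hFγ := (isBasis_cycleMatroid_iff E F γ).1 hF₀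
  have hdisjF : Disjoint F (Pe \ γ) := Finset.disjoint_left.2 fun e he he' => (Finset.mem_sdiff.1 he').2 (hFγ.1 he)
  have hFP : edgeRank E (F ∪ (Pe \ γ)) = (F ∪ (Pe \ γ)).card := by
    rw [edgeRank_union_eq_of_isBasis E hF₀ (Pe \ γ), union_sdiff_eq, hrk, Finset.card_union_of_disjoint hdisjF, hFγ.2.2]
  exact edgeRank_eq_card_of_subset hFP (Finset.union_subset_union (Finset.coe_subset.1 hF'F₀) (Finset.Subset.refl _))

/-- **The separation transfer** («вершины, инцидентные электронным внешним линиям, лежат в разных компонентах», for `G` and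
for `G′`): if a forest `F′ ⊆ γ` does NOT join `a` to `b`, then `F′ ∪ P` does not join `u` to `w` — otherwise `a ~_{F′∪P} b`
and `a ~_γ b` but `a ≁_{F′} b = (F′ ∪ P) ∩ γ`, and the strict submodularity of the rank across this disconnection
(`edgeRank_union_add_inter_add_one_le`) would force `rk(γ ∪ P) < rk γ + |P|`. [cite: Volkov2016, §5.1 p.1174 (definition of S) and §5.3 p.1177 (PDF p.14 L21–L31); Biggs1974, Ch. 4 Prop. 4.3] -/
theorem not_reachable_union_sdiff (hrk : edgeRank E (γ ∪ Pe) = edgeRank E γ + (Pe \ γ).card)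
    (hγab : (edgeGraph E γ).Reachable a b) (hPa : (edgeGraph E (Pe \ γ)).Reachable u a)
    (hPb : (edgeGraph E (Pe \ γ)).Reachable b w) {F' : Finset (Fin N)} (hF'γ : F' ⊆ γ)
    (hF' : edgeRank E F' = F'.card) (hab : ¬ (edgeGraph E F').Reachable a b) :
    ¬ (edgeGraph E (F' ∪ (Pe \ γ))).Reachable u w := by
  intro huw
  have hsub : Pe \ γ ⊆ F' ∪ (Pe \ γ) := Finset.subset_union_right
  have haFb : (edgeGraph E (F' ∪ (Pe \ γ))).Reachable a b :=
    ((hPa.mono (edgeGraph_mono hsub)).symm.trans huw).trans (hPb.mono (edgeGraph_mono hsub)).symm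
  have hI : (F' ∪ (Pe \ γ)) ∩ γ = F' := by
    ext e
    simp only [Finset.mem_inter, Finset.mem_union, Finset.mem_sdiff]
    constructor
    · rintro ⟨h1 | h1, h2⟩
      · exact h1
      · exact absurd h2 h1.2
    · intro h
      exact ⟨Or.inl h, hF'γ h⟩
  have hU : (F' ∪ (Pe \ γ)) ∪ γ = γ ∪ Pe := by
    ext e
    simp only [Finset.mem_union, Finset.mem_sdiff]
    constructor
    · rintro ((h | h) | h)
      · exact Or.inl (hF'γ h)
      · exact Or.inr h.1
      · exact Or.inl h
    · rintro (h | h)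
      · exact Or.inr h
      · by_cases he : e ∈ γ
        · exact Or.inr he
        · exact Or.inl (Or.inr ⟨h, he⟩)
  have key := edgeRank_union_add_inter_add_one_le E haFb hγab (by rw [hI]; exact hab)
  rw [hU, hI, hrk, hF'] at key
  have hle : edgeRank E (F' ∪ (Pe \ γ)) ≤ F'.card + (Pe \ γ).card :=
    (edgeRank_le_card E _).trans (Finset.card_union_le _ _)
  omega

/-- The converse transfer: if `F′` joins `a` to `b` then `F′ ∪ P` joins `u` to `w` (through `P₁`, `F′`, `P₂`). [cite: Volkov2016, §5.3 p.1177 (PDF p.14 L21–L31)] -/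
theorem reachable_union_sdiff_of_reachable (hPa : (edgeGraph E (Pe \ γ)).Reachable u a)
    (hPb : (edgeGraph E (Pe \ γ)).Reachable b w) {F' : Finset (Fin N)} (hab : (edgeGraph E F').Reachable a b) :
    (edgeGraph E (F' ∪ (Pe \ γ))).Reachable u w := by
  have hsub : Pe \ γ ⊆ F' ∪ (Pe \ γ) := Finset.subset_union_right
  exact ((hPa.mono (edgeGraph_mono hsub)).trans (hab.mono (edgeGraph_mono Finset.subset_union_left))).trans
    (hPb.mono (edgeGraph_mono hsub))

/-- **Conversion (a): `Ξ_{γ∪P}` at `P`-degree `0` IS `S_{G′}`.** The 2-trees of the subgraph `A = γ ∪ P` that contain all of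
`P` and separate `u` from `w` are exactly the sets `F′ ∪ P` with `F′` a 2-tree of `G′` separating `a` from `b`, and their chord
monomials inside `A` are those of `F′` inside `γ` — so the `P`-degree-`0` part of Brown's `Ξ_A` (kinematics of `G`, unit
momentum `u → w`, read from `u`) is Volkov's `S_{G′}` with ITS OWN external vertices `a`, `b`. [cite: Volkov2016, §5.3 p.1177 (PDF p.14 L21–L31: «W_{G′}, … V_{G′} строятся по правилам, аналогичным описанным выше») and (25); Brown2017, Prop. 2.4 (Φ_γ)] -/
theorem weightPart_secondSymanzikSub_union_eq (hrk : edgeRank E (γ ∪ Pe) = edgeRank E γ + (Pe \ γ).card)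
    (hγab : (edgeGraph E γ).Reachable a b) (hPa : (edgeGraph E (Pe \ γ)).Reachable u a)
    (hPb : (edgeGraph E (Pe \ γ)).Reachable b w) :
    weightPart (secondSymanzikSub E (γ ∪ Pe) (unitMomentum u w) (fun _ => (0 : ℝ)) u) (setIndicator (Pe \ γ)) 0 =
      twoTreePolynomialSub E γ a b := by
  unfold secondSymanzikSub twoTreePolynomialSub
  have h0 : (∑ e ∈ γ ∪ Pe, ((fun _ => (0 : ℝ)) e) ^ 2 • (X e : MvPolynomial (Fin N) ℝ)) = 0 := by simp
  rw [h0, mul_zero, add_zero, weightPart_sum]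
  -- each term: the separation indicator times the `P`-degree-0 test
  have hterm : ∀ F ∈ (γ ∪ Pe).powerset.filter (fun F' : Finset (Fin N) =>
      edgeRank E F' = F'.card ∧ F'.card + 1 = edgeRank E (γ ∪ Pe)),
      weightPart (‖∑ v ∈ univ.filter (fun v => (edgeGraph E F).Reachable u v), unitMomentum u w v‖ ^ 2 •
          ∏ e ∈ (γ ∪ Pe) \ F, (X e : MvPolynomial (Fin N) ℝ)) (setIndicator (Pe \ γ)) 0 =
        if Pe \ γ ⊆ F ∧ ¬ (edgeGraph E F).Reachable u w then ∏ e ∈ (γ ∪ Pe) \ F, (X e : MvPolynomial (Fin N) ℝ) else 0 := by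
    intro F hF
    have hFA : F ⊆ γ ∪ Pe := Finset.mem_powerset.1 (Finset.mem_filter.1 hF).1
    rw [weightPart_smul, weightPart_prod_X_setIndicator_zero, norm_sq_sum_unitMomentum]
    simp only [Finset.mem_filter, Finset.mem_univ, true_and, SimpleGraph.Reachable.refl, true_iff]
    have hD : Disjoint (Pe \ γ) ((γ ∪ Pe) \ F) ↔ Pe \ γ ⊆ F := by
      rw [Finset.disjoint_left]
      constructor
      · intro h e he
        by_contra heF
        exact h he (Finset.mem_sdiff.2 ⟨Finset.mem_union_right _ (Finset.mem_sdiff.1 he).1, heF⟩)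
      · intro h e he he'
        exact (Finset.mem_sdiff.1 he').2 (h he)
    by_cases h1 : (edgeGraph E F).Reachable u w
    · simp [h1]
    · by_cases h2 : Pe \ γ ⊆ F
      · rw [if_neg h1, if_pos (hD.2 h2), if_pos ⟨h2, h1⟩, one_smul]
      · rw [if_neg h1, if_neg (fun h => h2 (hD.1 h)), if_neg (fun h => h2 h.1), smul_zero]
  rw [Finset.sum_congr rfl hterm, ← Finset.sum_filter, Finset.filter_filter]
  -- the bijection `F′ ↦ F′ ∪ P`
  symm
  refine Finset.sum_nbij' (fun F' => F' ∪ (Pe \ γ)) (fun F => F \ (Pe \ γ)) ?_ ?_ ?_ ?_ ?_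
  · intro F' hF'
    rw [Finset.mem_filter, Finset.mem_powerset] at hF'
    obtain ⟨hF'γ, hF'i, hF'c, hab⟩ := hF'
    have hdisj : Disjoint F' (Pe \ γ) := Finset.disjoint_left.2 fun e he he' => (Finset.mem_sdiff.1 he').2 (hF'γ he)
    rw [Finset.mem_filter, Finset.mem_powerset]
    refine ⟨Finset.union_subset_union hF'γ Finset.sdiff_subset,
      ⟨edgeRank_union_sdiff_eq_card E hrk hF'γ hF'i, ?_⟩, Finset.subset_union_right,
      not_reachable_union_sdiff E hrk hγab hPa hPb hF'γ hF'i hab⟩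
    rw [Finset.card_union_of_disjoint hdisj, hrk, ← hF'c]
    ring
  · intro F hF
    rw [Finset.mem_filter, Finset.mem_powerset] at hF
    obtain ⟨hFA, ⟨hFi, hFc⟩, hPF, hsep⟩ := hF
    rw [Finset.mem_filter, Finset.mem_powerset]
    have hsubγ : F \ (Pe \ γ) ⊆ γ := by
      intro e he
      obtain ⟨heF, heP⟩ := Finset.mem_sdiff.1 he
      rcases Finset.mem_union.1 (hFA heF) with h | h
      · exact h
      · by_contra heγ
        exact heP (Finset.mem_sdiff.2 ⟨h, heγ⟩)
    refine ⟨hsubγ, edgeRank_eq_card_of_subset hFi Finset.sdiff_subset, ?_, fun hab => hsep ?_⟩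
    · rw [Finset.card_sdiff_of_subset hPF]
      have := Finset.card_le_card hPF
      omega
    · have h := reachable_union_sdiff_of_reachable E hPa hPb hab
      rwa [Finset.sdiff_union_of_subset hPF] at h
  · intro F' hF'
    have hF'γ : F' ⊆ γ := Finset.mem_powerset.1 (Finset.mem_filter.1 hF').1
    have hdisj : Disjoint F' (Pe \ γ) := Finset.disjoint_left.2 fun e he he' => (Finset.mem_sdiff.1 he').2 (hF'γ he)
    show (F' ∪ (Pe \ γ)) \ (Pe \ γ) = F'
    rw [Finset.union_sdiff_right, hdisj.sdiff_eq_left]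
  · intro F hF
    have hPF : Pe \ γ ⊆ F := (Finset.mem_filter.1 hF).2.2.1
    show (F \ (Pe \ γ)) ∪ (Pe \ γ) = F
    exact Finset.sdiff_union_of_subset hPF
  · intro F' hF'
    have hF'γ : F' ⊆ γ := Finset.mem_powerset.1 (Finset.mem_filter.1 hF').1
    show ∏ e ∈ γ \ F', (X e : MvPolynomial (Fin N) ℝ) = ∏ e ∈ (γ ∪ Pe) \ (F' ∪ (Pe \ γ)), X e
    congr 1
    ext e
    simp only [Finset.mem_sdiff, Finset.mem_union]
    constructor
    · rintro ⟨h1, h2⟩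
      exact ⟨Or.inl h1, fun h => h.elim h2 fun h' => h'.2 h1⟩
    · rintro ⟨h1 | h1, h2⟩
      · exact ⟨h1, fun h => h2 (Or.inl h)⟩
      · by_cases he : e ∈ γ
        · exact ⟨he, fun h => h2 (Or.inl h)⟩
        · exact absurd (Or.inr ⟨h1, he⟩) h2

/-- `P` is independent in `M(G)/γ` when it closes no cycle with `G′`. [cite: Oxley2011, §3.1 Prop. 3.1.7; Volkov2016, §5.2 p.1175 (PDF p.12 L86–L88)] -/
theorem contract_indep_sdiff (hrk : edgeRank E (γ ∪ Pe) = edgeRank E γ + (Pe \ γ).card) :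
    ((cycleMatroid E) ／ (↑γ : Set (Fin N))).Indep (↑(Pe \ γ) : Set (Fin N)) := by
  obtain ⟨F, hF⟩ := exists_isBasis_cycleMatroid E γ
  have hFγ := (isBasis_cycleMatroid_iff E F γ).1 hF
  have hdisj : Disjoint (γ : Set (Fin N)) ((Pe \ γ : Finset (Fin N)) : Set (Fin N)) := by
    rw [Finset.disjoint_coe]
    exact Finset.disjoint_sdiff
  have hdisjF : Disjoint (Pe \ γ) F := Finset.disjoint_left.2 fun e he heF => (Finset.mem_sdiff.1 he).2 (hFγ.1 heF)
  rw [hF.contract_indep_iff_of_disjoint hdisj, ← Finset.coe_union, indep_cycleMatroid_iff_edgeRank, Finset.union_comm,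
    edgeRank_union_eq_of_isBasis E hF, union_sdiff_eq, hrk, Finset.union_comm, Finset.card_union_of_disjoint hdisjF,
    hFγ.2.2, add_comm]

/-- **Conversion (b): `Ψ_{G/(G′∪P)}` IS `Ψ_{G/G′}` at `P`-degree `0`.** The spanning trees of `G/G′` containing `P` are the sets
`T⁺ ∪ P`, `T⁺` a spanning tree of `G/(G′ ∪ P₁ ∪ P₂)` (`M/(γ ∪ P) = (M/γ)/P` with `P` independent in `M/γ`), with the same chord
monomials. [cite: Volkov2016, §5.2 p.1175 (PDF p.12 L86–L88) and §5.3 (24)–(25); Oxley2011, §3.1 Prop. 3.1.7 and Prop. 3.1.26 (contraction of a union)] -/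
theorem weightPart_kirchhoffQuot_setIndicator_zero (hrk : edgeRank E (γ ∪ Pe) = edgeRank E γ + (Pe \ γ).card) :
    weightPart (kirchhoffQuot E γ) (setIndicator (Pe \ γ)) 0 = kirchhoffQuot E (γ ∪ Pe) := by
  have hPind := contract_indep_sdiff E hrk
  have hMA : (cycleMatroid E) ／ (↑(γ ∪ Pe) : Set (Fin N)) =
      ((cycleMatroid E) ／ (↑γ : Set (Fin N))) ／ (↑(Pe \ γ) : Set (Fin N)) := by
    rw [contract_contract, ← Finset.coe_union, union_sdiff_eq]
  unfold kirchhoffQuot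
  rw [weightPart_sum]
  have hterm : ∀ T ∈ γᶜ.powerset.filter
      (fun T' : Finset (Fin N) => ((cycleMatroid E) ／ (↑γ : Set (Fin N))).IsBase (↑T' : Set (Fin N))),
      weightPart (∏ e ∈ γᶜ \ T, (X e : MvPolynomial (Fin N) ℝ)) (setIndicator (Pe \ γ)) 0 =
        if Pe \ γ ⊆ T then ∏ e ∈ γᶜ \ T, (X e : MvPolynomial (Fin N) ℝ) else 0 := by
    intro T _
    rw [weightPart_prod_X_setIndicator_zero]
    have hD : Disjoint (Pe \ γ) (γᶜ \ T) ↔ Pe \ γ ⊆ T := by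
      rw [Finset.disjoint_left]
      constructor
      · intro h e he
        by_contra heT
        exact h he (Finset.mem_sdiff.2 ⟨Finset.mem_compl.2 (Finset.mem_sdiff.1 he).2, heT⟩)
      · intro h e he he'
        exact (Finset.mem_sdiff.1 he').2 (h he)
    simp only [hD]
  rw [Finset.sum_congr rfl hterm, ← Finset.sum_filter]
  symm
  refine Finset.sum_nbij' (fun T => T ∪ (Pe \ γ)) (fun T => T \ (Pe \ γ)) ?_ ?_ ?_ ?_ ?_
  · intro T hT
    rw [Finset.mem_filter, Finset.mem_powerset] at hT
    obtain ⟨hTA, hTb⟩ := hT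
    rw [hMA, hPind.contract_isBase_iff, ← Finset.coe_union] at hTb
    rw [Finset.mem_filter, Finset.mem_filter, Finset.mem_powerset]
    refine ⟨⟨?_, hTb.1⟩, Finset.subset_union_right⟩
    intro e he
    rw [Finset.mem_compl]
    rcases Finset.mem_union.1 he with h | h
    · exact fun heγ => (Finset.mem_compl.1 (hTA h)) (Finset.mem_union_left _ heγ)
    · exact (Finset.mem_sdiff.1 h).2
  · intro T hT
    rw [Finset.mem_filter, Finset.mem_filter, Finset.mem_powerset] at hT
    obtain ⟨⟨hTγ, hTb⟩, hPT⟩ := hT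
    rw [Finset.mem_filter, Finset.mem_powerset, hMA, hPind.contract_isBase_iff, ← Finset.coe_union,
      Finset.sdiff_union_of_subset hPT, Finset.disjoint_coe]
    refine ⟨?_, hTb, Finset.sdiff_disjoint⟩
    intro e he
    obtain ⟨heT, heP⟩ := Finset.mem_sdiff.1 he
    have heγ : e ∉ γ := Finset.mem_compl.1 (hTγ heT)
    rw [Finset.mem_compl, Finset.mem_union, not_or]
    exact ⟨heγ, fun hePe => heP (Finset.mem_sdiff.2 ⟨hePe, heγ⟩)⟩
  · intro T hT
    have hTA : T ⊆ (γ ∪ Pe)ᶜ := Finset.mem_powerset.1 (Finset.mem_filter.1 hT).1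
    have hdisj : Disjoint T (Pe \ γ) := Finset.disjoint_left.2 fun e he he' =>
      (Finset.mem_compl.1 (hTA he)) (Finset.mem_union_right _ (Finset.mem_sdiff.1 he').1)
    show (T ∪ (Pe \ γ)) \ (Pe \ γ) = T
    rw [Finset.union_sdiff_right, hdisj.sdiff_eq_left]
  · intro T hT
    have hPT : Pe \ γ ⊆ T := (Finset.mem_filter.1 hT).2
    show (T \ (Pe \ γ)) ∪ (Pe \ γ) = T
    exact Finset.sdiff_union_of_subset hPT
  · intro T hT
    show ∏ e ∈ (γ ∪ Pe)ᶜ \ T, (X e : MvPolynomial (Fin N) ℝ) = ∏ e ∈ γᶜ \ (T ∪ (Pe \ γ)), X e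
    congr 1
    ext e
    simp only [Finset.mem_sdiff, Finset.mem_compl, Finset.mem_union, not_or]
    constructor
    · rintro ⟨⟨h1, h2⟩, h3⟩
      exact ⟨h1, h3, fun h => h2 h.1⟩
    · rintro ⟨h1, h2, h3⟩
      exact ⟨⟨h1, fun h => h3 ⟨h, h1⟩⟩, h2⟩

end Conversion

/-! ## §6 THE COMBINATORIAL CORE OF (25): the weight-`(2ℓ(γ) + 2)` part of `S` along the IR vector is `V_{G′}·(S_{G/G′})₂ + S_{G′}·(V_{G/G′})₀`

«Основная идея здесь в том, что если все величины … расписать в виде суммы произведений, оставить только доминирующие по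
степени δ слагаемые, то мы получим точные равенства» — here for `S`: along `β = 𝟙_γ + 𝟙_{γ∪Pe}` (2 on `G′`, 1 on `P₁ ∪ P₂`,
0 elsewhere) a separating 2-tree monomial has weight `deg_γ + deg_A` with `deg_γ ≥ ℓ(γ)` (UV: `|F ∩ γ| ≤ rk γ`) and
`deg_A ≥ ℓ(A) + 1` (IR: a 2-tree meeting the momentum-spanning `A` maximally does not separate), so weight `2ℓ + 2` (`ℓ(A) =
ℓ(γ) = ℓ`) splits into EXACTLY two classes — `(deg_γ, deg_A) = (ℓ, ℓ+2)`: Brown's UV class at `γ` with two `P`-chords, giving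
`V_{G′}·(S_{G/G′})₂`; and `(ℓ+1, ℓ+1)`: Brown's IR class `C₁` at `A` with NO `P`-chord, giving (conversion (a), (b))
`S_{G′}·(V_{G/G′})₀`. -/

section Core

variable {N V : ℕ} (E : Fin N → Fin (V + 1) × Fin (V + 1))
variable {γ Pe : Finset (Fin N)} {u w a b : Fin (V + 1)}

/-- `ℓ(γ ∪ Pe) = ℓ(γ)` in rank form: `rk(γ ∪ Pe) = rk γ + |Pe ∖ γ|`. [cite: Volkov2016, §5.2 p.1175 (PDF p.12 L86–L88)] -/
theorem edgeRank_union_eq_of_loopNumber_eq (hℓ : loopNumber E (γ ∪ Pe) = loopNumber E γ) :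
    edgeRank E (γ ∪ Pe) = edgeRank E γ + (Pe \ γ).card := by
  have h1 : edgeRank E (γ ∪ Pe) ≤ (γ ∪ Pe).card := edgeRank_le_card E _
  have h2 : edgeRank E γ ≤ γ.card := edgeRank_le_card E _
  have h3 : (γ ∪ Pe).card = γ.card + (Pe \ γ).card := by
    rw [← Finset.union_sdiff_self_eq_union, Finset.card_union_of_disjoint Finset.disjoint_sdiff]
  have h4 : edgeRank E γ ≤ edgeRank E (γ ∪ Pe) := edgeRank_mono Finset.subset_union_left
  unfold loopNumber at hℓ
  omega

/-- `u ~_{γ ∪ Pe} w`: through `P₁`, `G′`, `P₂`. [cite: Volkov2016, §5.2 p.1175–1176] -/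
theorem reachable_union_of_paths (hγab : (edgeGraph E γ).Reachable a b) (hPa : (edgeGraph E (Pe \ γ)).Reachable u a)
    (hPb : (edgeGraph E (Pe \ γ)).Reachable b w) : (edgeGraph E (γ ∪ Pe)).Reachable u w := by
  have hP : Pe \ γ ⊆ γ ∪ Pe := Finset.sdiff_subset.trans Finset.subset_union_right
  exact ((hPa.mono (edgeGraph_mono hP)).trans (hγab.mono (edgeGraph_mono Finset.subset_union_left))).trans
    (hPb.mono (edgeGraph_mono hP))

/-- `γ ∪ Pe` is mass-momentum spanning for the unit momentum `u → w` (massless) once it joins `u` to `w`. [cite: Brown2017, Def. 1.8 / 2.6] -/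
theorem isMassMomentumSpanning_unitMomentum {A : Finset (Fin N)} (huw : (edgeGraph E A).Reachable u w) :
    IsMassMomentumSpanning E (unitMomentum u w) (fun _ => (0 : ℝ)) A := by
  refine ⟨fun e he => absurd rfl he, fun x y hx hy => ?_⟩
  rcases eq_or_eq_of_unitMomentum_ne_zero hx with rfl | rfl <;>
    rcases eq_or_eq_of_unitMomentum_ne_zero hy with rfl | rfl
  · exact SimpleGraph.Reachable.refl _
  · exact huw
  · exact huw.symm
  · exact SimpleGraph.Reachable.refl _

/-- `u` reaches every momentum-carrying vertex inside `A`. [cite: Brown2017, Prop. 2.4 (proof, "γ' is momentum spanning")] -/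
theorem reachable_of_unitMomentum_ne_zero {A : Finset (Fin N)} (huw : (edgeGraph E A).Reachable u w) :
    ∀ v, unitMomentum u w v ≠ 0 → (edgeGraph E A).Reachable u v := by
  intro v hv
  rcases eq_or_eq_of_unitMomentum_ne_zero hv with rfl | rfl
  · exact SimpleGraph.Reachable.refl _
  · exact huw

/-- A monomial of `p` is a monomial of `q` or of `p − q`. [folklore] -/
private theorem mem_support_or_mem_support_sub (p q : MvPolynomial (Fin N) ℝ) {d : Fin N →₀ ℕ} (hd : d ∈ p.support) :
    d ∈ q.support ∨ d ∈ (p - q).support := by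
  by_cases hq : d ∈ q.support
  · exact Or.inl hq
  · refine Or.inr (mem_support_iff.2 ?_)
    rw [coeff_sub, notMem_support_iff.1 hq, sub_zero]
    exact mem_support_iff.1 hd

/-- **UV: every monomial of `S` has `deg_γ ≥ ℓ(γ)`** (Brown Prop. 2.2: leading part `Ψ_γ Φ_{G/γ}` of `γ`-degree `h_γ`,
remainder of higher degree). [cite: Brown2017, Prop. 2.2 / Thm 2.7 (arXiv:1512.06409 §2.1, §2.3)] -/
theorem loopNumber_le_sdeg_of_mem_support_twoTreePolynomial (hconn : IsConnectedEdgeList E) (γ : Finset (Fin N))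
    {d : Fin N →₀ ℕ} (hd : d ∈ (twoTreePolynomial ℝ E u w).support) : loopNumber E γ ≤ ∑ e ∈ γ, d e := by
  rw [twoTreePolynomial_eq_secondSymanzikPolynomial] at hd
  rcases mem_support_or_mem_support_sub _
      (kirchhoffSub E γ * secondSymanzikQuot E γ (unitMomentum u w) (fun _ => (0 : ℝ))) hd with h | h
  · exact (gammaDeg_of_mem_support_kirchhoffSub_mul_secondSymanzikQuot E h).ge
  · exact (Nat.le_succ _).trans (le_gammaDeg_of_mem_support_uv_remainder E hconn γ _ _ h)

/-- **UV: the `deg_γ = ℓ(γ)` part of `S` is `V_{G′}·S_{G/G′}`** (Brown Prop. 2.2 second line for Volkov's `S`).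
[cite: Brown2017, Prop. 2.2 (arXiv:1512.06409 §2.1); Volkov2016, §5.3 p.1177 (PDF p.15 L88–L91)] -/
theorem weightPart_twoTreePolynomial_setIndicator_eq (hconn : IsConnectedEdgeList E) (γ : Finset (Fin N)) :
    weightPart (twoTreePolynomial ℝ E u w) (setIndicator γ) (loopNumber E γ) =
      kirchhoffSub E γ * secondSymanzikQuot E γ (unitMomentum u w) (fun _ => (0 : ℝ)) := by
  rw [twoTreePolynomial_eq_secondSymanzikPolynomial]
  refine weightPart_eq_of_remainder (fun d hd => ?_) (fun d hd => ?_)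
  · rw [linPair_castExp_setIndicator, gammaDeg_of_mem_support_kirchhoffSub_mul_secondSymanzikQuot E hd]
  · rw [linPair_castExp_setIndicator, ne_eq, Nat.cast_inj]
    have := le_gammaDeg_of_mem_support_uv_remainder E hconn γ _ _ hd
    omega

/-- **IR: every monomial of `S` has `deg_A ≥ ℓ(A) + 1` for `A = γ ∪ Pe` joining `u` to `w`** (Brown Prop. 2.4 at the
momentum-spanning `A`: a 2-tree meeting `A` in a 1-tree of `A` would not separate `u` from `w`). [cite: Brown2017, Prop. 2.4 / Thm 2.7 (arXiv:1512.06409 §2.2–2.3); Volkov2016, §5.2 p.1175 (PDF p.12 L86–L88)] -/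
theorem loopNumber_succ_le_sdeg_of_mem_support_twoTreePolynomial (hconn : IsConnectedEdgeList E)
    (huw : (edgeGraph E (γ ∪ Pe)).Reachable u w) {d : Fin N →₀ ℕ} (hd : d ∈ (twoTreePolynomial ℝ E u w).support) :
    loopNumber E (γ ∪ Pe) + 1 ≤ ∑ e ∈ γ ∪ Pe, d e := by
  rw [twoTreePolynomial_eq_secondSymanzikPolynomial] at hd
  rcases mem_support_or_mem_support_sub _
      (secondSymanzikSub E (γ ∪ Pe) (unitMomentum u w) (fun _ => (0 : ℝ)) u * kirchhoffQuot E (γ ∪ Pe)) hd with h | h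
  · exact (gammaDeg_of_mem_support_secondSymanzikSub_mul_kirchhoffQuot E h).ge
  · exact (Nat.le_succ _).trans (le_gammaDeg_of_mem_support_ir_remainder E hconn (sum_unitMomentum u w)
      (isMassMomentumSpanning_unitMomentum E huw) (reachable_of_unitMomentum_ne_zero E huw) h)

/-- **IR: the `deg_A = ℓ(A) + 1` part of `S` is `Ξ_A·Ψ_{G/A}`** (Brown Prop. 2.4 for Volkov's `S` at `A = γ ∪ Pe`).
[cite: Brown2017, Prop. 2.4 (arXiv:1512.06409 §2.2); Volkov2016, §5.3 p.1177 (PDF p.15 L88–L91)] -/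
theorem weightPart_twoTreePolynomial_setIndicator_union_eq (hconn : IsConnectedEdgeList E)
    (huw : (edgeGraph E (γ ∪ Pe)).Reachable u w) :
    weightPart (twoTreePolynomial ℝ E u w) (setIndicator (γ ∪ Pe)) ((loopNumber E (γ ∪ Pe) : ℝ) + 1) =
      secondSymanzikSub E (γ ∪ Pe) (unitMomentum u w) (fun _ => (0 : ℝ)) u * kirchhoffQuot E (γ ∪ Pe) := by
  rw [twoTreePolynomial_eq_secondSymanzikPolynomial]
  refine weightPart_eq_of_remainder (fun d hd => ?_) (fun d hd => ?_)
  · rw [linPair_castExp_setIndicator, gammaDeg_of_mem_support_secondSymanzikSub_mul_kirchhoffQuot E hd]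
    push_cast
    ring
  · rw [linPair_castExp_setIndicator, show (loopNumber E (γ ∪ Pe) : ℝ) + 1 = ((loopNumber E (γ ∪ Pe) + 1 : ℕ) : ℝ) by
      push_cast; ring, ne_eq, Nat.cast_inj]
    have := le_gammaDeg_of_mem_support_ir_remainder E hconn (sum_unitMomentum u w)
      (isMassMomentumSpanning_unitMomentum E huw) (reachable_of_unitMomentum_ne_zero E huw) hd
    omega

/-- A monomial of `Ψ_γ` lives in the `γ`-variables. [cite: Brown2017, Prop. 2.2 (Ψ_γ)] -/
theorem apply_eq_zero_of_mem_support_kirchhoffSub {γ : Finset (Fin N)} {d : Fin N →₀ ℕ}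
    (hd : d ∈ (kirchhoffSub E γ).support) {e : Fin N} (he : e ∉ γ) : d e = 0 := by
  unfold kirchhoffSub at hd
  obtain ⟨F, -, hdF⟩ := Finset.mem_biUnion.1 (support_sum hd)
  rw [prod_X_eq_monomial_sum] at hdF
  rw [Finset.mem_singleton.1 (support_monomial_subset hdF), Finsupp.coe_finsetSum, Finset.sum_apply]
  refine Finset.sum_eq_zero fun e' he' => ?_
  rw [Finsupp.single_apply, if_neg]
  rintro rfl
  exact he (Finset.mem_sdiff.1 he').1

/-- A monomial of `Ψ_γ` has the same degree in any `A ⊇ γ` as in `γ`: `ℓ(γ)`. [cite: Brown2017, Prop. 2.2 ("deg Ψ_γ = h_γ")] -/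
theorem sdeg_of_mem_support_kirchhoffSub_of_subset {γ A : Finset (Fin N)} (hγA : γ ⊆ A) {d : Fin N →₀ ℕ}
    (hd : d ∈ (kirchhoffSub E γ).support) : ∑ e ∈ A, d e = loopNumber E γ := by
  rw [← gammaDeg_of_mem_support_kirchhoffSub E hd]
  symm
  exact Finset.sum_subset hγA fun e _ he => apply_eq_zero_of_mem_support_kirchhoffSub E hd he

/-- Degrees in `A = γ ∪ Pe` split as `deg_A = deg_γ + deg_{Pe∖γ}`. [folklore] -/
private theorem sdeg_union_eq (γ Pe : Finset (Fin N)) (d : Fin N →₀ ℕ) :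
    ∑ e ∈ γ ∪ Pe, d e = ∑ e ∈ γ, d e + ∑ e ∈ Pe \ γ, d e := by
  rw [← Finset.union_sdiff_self_eq_union, Finset.sum_union Finset.disjoint_sdiff]

/-- **THE COMBINATORIAL CORE OF (25).** For a connected edge list `E`, a line set `γ` («G′»), electron lines `Pe`, external
electron vertices `u`, `w` of `G` and `a`, `b` of `G′`, under the §5.2 hypotheses in edge-list form — `ℓ(γ ∪ Pe) = ℓ(γ)`,
`a ~_γ b`, `u ~_{Pe∖γ} a`, `b ~_{Pe∖γ} w` — the weight-`(2ℓ(γ)+2)` part of `S` along the IR vector `β = 𝟙_γ + 𝟙_{γ∪Pe}` is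
`V_{G′} · (S_{G/G′})₂ + S_{G′} · (V_{G/G′})₀` (subscripts = weight parts along `β`; `V_{G′}`, `S_{G′}` are `β`-homogeneous of
weights `2ℓ(γ)`, `2ℓ(γ)+2`). This is the `S`-content of «оставить только доминирующие по степени δ слагаемые, то мы получим
точные равенства» for (25). [cite: Volkov2016, §5.3 (25) (p.1177, PDF p.15 L85–L91); Brown2017, Prop. 2.2 and Prop. 2.4 (arXiv:1512.06409 §2.1–2.2)] -/
theorem weightPart_twoTreePolynomial_irVector (hconn : IsConnectedEdgeList E)
    (hℓ : loopNumber E (γ ∪ Pe) = loopNumber E γ) (hγab : (edgeGraph E γ).Reachable a b)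
    (hPa : (edgeGraph E (Pe \ γ)).Reachable u a) (hPb : (edgeGraph E (Pe \ γ)).Reachable b w) :
    weightPart (twoTreePolynomial ℝ E u w) (irVector γ Pe)
        (2 * (loopNumber E γ : ℝ) + 2) =
      subgraphPolynomial E γ *
          weightPart (twoTreePolynomialQuot E γ u w) (irVector γ Pe) 2 +
        twoTreePolynomialSub E γ a b *
          weightPart (quotientPolynomial E γ) (irVector γ Pe) 0 := by
  have hrk := edgeRank_union_eq_of_loopNumber_eq E hℓ
  have huw := reachable_union_of_paths E hγab hPa hPb
  set S := twoTreePolynomial ℝ E u w with hSdef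
  set LUV := kirchhoffSub E γ * secondSymanzikQuot E γ (unitMomentum u w) (fun _ => (0 : ℝ)) with hLUV
  set LIR := secondSymanzikSub E (γ ∪ Pe) (unitMomentum u w) (fun _ => (0 : ℝ)) u * kirchhoffQuot E (γ ∪ Pe) with hLIR
  have hS2 : weightPart S (setIndicator γ) (loopNumber E γ) = LUV := weightPart_twoTreePolynomial_setIndicator_eq E hconn γ
  have hS4 : weightPart S (setIndicator (γ ∪ Pe)) ((loopNumber E γ : ℝ) + 1) = LIR := by
    have h4 := weightPart_twoTreePolynomial_setIndicator_union_eq E hconn huw (u := u) (w := w)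
    rwa [hℓ] at h4
  -- Step A: the weight-(2ℓ+2) part splits into the two classes
  have hA : weightPart S (irVector γ Pe) (2 * (loopNumber E γ : ℝ) + 2) =
      weightPart LUV (setIndicator (γ ∪ Pe)) ((loopNumber E γ : ℝ) + 2) +
        weightPart LIR (setIndicator γ) ((loopNumber E γ : ℝ) + 1) := by
    rw [← hS2, ← hS4]
    ext d
    simp only [coeff_add, coeff_weightPart, linPair_castExp_irVector, linPair_castExp_setIndicator]
    by_cases hd : coeff d S = 0
    · simp [hd]
    · have hdS : d ∈ S.support := mem_support_iff.2 hd
      have h1 : loopNumber E γ ≤ ∑ e ∈ γ, d e := loopNumber_le_sdeg_of_mem_support_twoTreePolynomial E hconn γ hdS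
      have h3 : loopNumber E γ + 1 ≤ ∑ e ∈ γ ∪ Pe, d e := by
        have h3' := loopNumber_succ_le_sdeg_of_mem_support_twoTreePolynomial E hconn huw hdS
        rwa [hℓ] at h3'
      have h5 : ∑ e ∈ γ, d e ≤ ∑ e ∈ γ ∪ Pe, d e :=
        Finset.sum_le_sum_of_subset (Finset.subset_union_left)
      have c0 : ((∑ e ∈ γ, d e + ∑ e ∈ γ ∪ Pe, d e : ℕ) : ℝ) = 2 * (loopNumber E γ : ℝ) + 2 ↔
          ∑ e ∈ γ, d e + ∑ e ∈ γ ∪ Pe, d e = 2 * loopNumber E γ + 2 := by norm_cast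
      have c1 : ((∑ e ∈ γ ∪ Pe, d e : ℕ) : ℝ) = (loopNumber E γ : ℝ) + 2 ↔ ∑ e ∈ γ ∪ Pe, d e = loopNumber E γ + 2 := by
        norm_cast
      have c2 : ((∑ e ∈ γ, d e : ℕ) : ℝ) = (loopNumber E γ : ℝ) ↔ ∑ e ∈ γ, d e = loopNumber E γ := by norm_cast
      have c3 : ((∑ e ∈ γ, d e : ℕ) : ℝ) = (loopNumber E γ : ℝ) + 1 ↔ ∑ e ∈ γ, d e = loopNumber E γ + 1 := by norm_cast
      have c4 : ((∑ e ∈ γ ∪ Pe, d e : ℕ) : ℝ) = (loopNumber E γ : ℝ) + 1 ↔ ∑ e ∈ γ ∪ Pe, d e = loopNumber E γ + 1 := by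
        norm_cast
      simp only [c0, c1, c2, c3, c4]
      by_cases e0 : ∑ e ∈ γ, d e + ∑ e ∈ γ ∪ Pe, d e = 2 * loopNumber E γ + 2
      · rw [if_pos e0]
        by_cases e2 : ∑ e ∈ γ, d e = loopNumber E γ
        · have e1 : ∑ e ∈ γ ∪ Pe, d e = loopNumber E γ + 2 := by omega
          have e3 : ¬ ∑ e ∈ γ, d e = loopNumber E γ + 1 := by omega
          rw [if_pos e1, if_pos e2, if_neg e3, add_zero]
        · have e3 : ∑ e ∈ γ, d e = loopNumber E γ + 1 := by omega
          have e4 : ∑ e ∈ γ ∪ Pe, d e = loopNumber E γ + 1 := by omega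
          have e1 : ¬ ∑ e ∈ γ ∪ Pe, d e = loopNumber E γ + 2 := by omega
          rw [if_neg e1, if_pos e3, if_pos e4, zero_add]
      · rw [if_neg e0]
        have f1 : ¬ (∑ e ∈ γ ∪ Pe, d e = loopNumber E γ + 2 ∧ ∑ e ∈ γ, d e = loopNumber E γ) := by omega
        have f2 : ¬ (∑ e ∈ γ, d e = loopNumber E γ + 1 ∧ ∑ e ∈ γ ∪ Pe, d e = loopNumber E γ + 1) := by omega
        by_cases g1 : ∑ e ∈ γ ∪ Pe, d e = loopNumber E γ + 2
        · have g2 : ¬ ∑ e ∈ γ, d e = loopNumber E γ := fun h' => f1 ⟨g1, h'⟩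
          by_cases g3 : ∑ e ∈ γ, d e = loopNumber E γ + 1
          · have g4 : ¬ ∑ e ∈ γ ∪ Pe, d e = loopNumber E γ + 1 := fun h' => f2 ⟨g3, h'⟩
            rw [if_pos g1, if_neg g2, if_pos g3, if_neg g4, add_zero]
          · rw [if_pos g1, if_neg g2, if_neg g3, add_zero]
        · by_cases g3 : ∑ e ∈ γ, d e = loopNumber E γ + 1
          · have g4 : ¬ ∑ e ∈ γ ∪ Pe, d e = loopNumber E γ + 1 := fun h' => f2 ⟨g3, h'⟩
            rw [if_neg g1, if_pos g3, if_neg g4, add_zero]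
          · rw [if_neg g1, if_neg g3, add_zero]
  -- Step B: the UV class
  have hB : weightPart LUV (setIndicator (γ ∪ Pe)) ((loopNumber E γ : ℝ) + 2) =
      subgraphPolynomial E γ *
        weightPart (twoTreePolynomialQuot E γ u w) (irVector γ Pe) 2 := by
    rw [hLUV, weightPart_mul_left (fun d hd => by
      rw [linPair_castExp_setIndicator, sdeg_of_mem_support_kirchhoffSub_of_subset E Finset.subset_union_left hd]),
      subgraphPolynomial_eq_kirchhoffSub, twoTreePolynomialQuot_eq_secondSymanzikQuot]
    congr 1
    refine weightPart_congr fun d hd => ?_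
    rw [linPair_castExp_setIndicator, linPair_castExp_irVector, gammaDeg_of_mem_support_secondSymanzikQuot E hd, zero_add]
  -- Step C: the IR class
  have hC : weightPart LIR (setIndicator γ) ((loopNumber E γ : ℝ) + 1) =
      twoTreePolynomialSub E γ a b *
        weightPart (quotientPolynomial E γ) (irVector γ Pe) 0 := by
    rw [hLIR, ← add_zero ((loopNumber E γ : ℝ) + 1), weightPart_mul_right (fun d hd => by
      rw [linPair_castExp_setIndicator, Nat.cast_eq_zero]
      have h0 := gammaDeg_of_mem_support_kirchhoffQuot E hd
      have := Finset.sum_le_sum_of_subset (f := fun e => d e) (Finset.subset_union_left (s₁ := γ) (s₂ := Pe))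
      omega)]
    congr 1
    · rw [← weightPart_secondSymanzikSub_union_eq E hrk hγab hPa hPb]
      refine weightPart_congr fun d hd => ?_
      have hdeg := gammaDeg_of_mem_support_secondSymanzikSub E hd
      rw [linPair_castExp_setIndicator, linPair_castExp_setIndicator, Nat.cast_eq_zero,
        show (loopNumber E γ : ℝ) + 1 = ((loopNumber E γ + 1 : ℕ) : ℝ) by push_cast; ring, Nat.cast_inj]
      rw [sdeg_union_eq, hℓ] at hdeg
      omega
    · rw [quotientPolynomial_eq_kirchhoffQuot, ← weightPart_kirchhoffQuot_setIndicator_zero E hrk]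
      refine weightPart_congr fun d hd => ?_
      have h0 := gammaDeg_of_mem_support_kirchhoffQuot E hd
      rw [linPair_castExp_setIndicator, linPair_castExp_irVector, Nat.cast_eq_zero, Nat.cast_eq_zero, sdeg_union_eq, h0]
      omega
  rw [hA, hB, hC]

end Core

/-! ## §7 (25) FOR THE ON-SHELL DENOMINATOR: the weight-`(2ℓ(γ)+2)` part of `W = S − V·z_e` is `V_{G′}·(W_{G/G′})₂ + W_{G′}·(V_{G/G′})₀`

From §6 and Brown's factorisation of `V` (`V = V_{G′}V_{G/G′} + R^Ψ`, `deg_γ R^Ψ > ℓ(γ)`, the companion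
`KirchhoffFactorization.lean`) by graded algebra: `z_e = z_{e′} + z_{e″}` with `z_{e′}` (electron lines in `G′`) of weight `2` and
`z_{e″}` (lines of `P₁ ∪ P₂`) of weight `1`, `(V)_{2ℓ} = V_{G′}(V_{G/G′})₀`, `(V)_{2ℓ+1} = V_{G′}(V_{G/G′})₁`. The only extra
hypothesis is `Pe ⊆ γ ∪ Pe` — automatic. -/

section OnShell

variable {N V : ℕ} (E : Fin N → Fin (V + 1) × Fin (V + 1))
variable {γ Pe : Finset (Fin N)} {u w a b : Fin (V + 1)}

/-- The monomials of `z_S = Σ_{e∈S} z_e` are the `z_e`, `e ∈ S`. [folklore] -/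
private theorem exists_eq_single_of_mem_support_lineSum {S : Finset (Fin N)} {d : Fin N →₀ ℕ}
    (hd : d ∈ (lineSum ℝ S).support) : ∃ e ∈ S, d = Finsupp.single e 1 := by
  unfold lineSum at hd
  obtain ⟨e, he, hde⟩ := Finset.mem_biUnion.1 (support_sum hd)
  rw [support_X, Finset.mem_singleton] at hde
  exact ⟨e, he, hde⟩

/-- The weight of `z_e` along `𝟙_γ + 𝟙_A` is `[e ∈ γ] + [e ∈ A]`. [cite: Volkov2016, §5.2 p.1175 (PDF p.12 L81–L85)] -/
theorem linPair_castExp_single_twoLevel (e : Fin N) (γ A : Finset (Fin N)) :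
    linPair (castExp (Finsupp.single e 1)) (fun e' => setIndicator γ e' + setIndicator A e') =
      (if e ∈ γ then 1 else 0) + (if e ∈ A then 1 else 0) := by
  rw [linPair_castExp_twoLevel]
  have h1 : ∀ S : Finset (Fin N), ∑ e' ∈ S, (Finsupp.single e 1 : Fin N →₀ ℕ) e' = if e ∈ S then 1 else 0 := fun S => by
    simp only [Finsupp.single_apply]
    rw [Finset.sum_ite_eq]
  rw [h1, h1]
  push_cast
  rfl

/-- `z_{e′}` (electron lines inside `G′`) is homogeneous of weight `2` along the IR vector. [cite: Volkov2016, §5.2 p.1175 (PDF p.12 L81–L85)] -/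
theorem linPair_of_mem_support_lineSum_inter {d : Fin N →₀ ℕ} (hd : d ∈ (lineSum ℝ (Pe ∩ γ)).support) :
    linPair (castExp d) (irVector γ Pe) = 2 := by
  obtain ⟨e, he, rfl⟩ := exists_eq_single_of_mem_support_lineSum hd
  have heγ : e ∈ γ := (Finset.mem_inter.1 he).2
  rw [irVector_eq, linPair_castExp_single_twoLevel, if_pos heγ, if_pos (Finset.mem_union_left _ heγ)]
  norm_num

/-- `z_{e″}` (electron lines of `P₁ ∪ P₂`) is homogeneous of weight `1` along the IR vector («z_l тоже по порядку не больше δ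
(потому что l — электронная линия)»). [cite: Volkov2016, §5.2 p.1175–1177 (PDF p.12 L81–L85, p.14 L1–L3)] -/
theorem linPair_of_mem_support_lineSum_sdiff {d : Fin N →₀ ℕ} (hd : d ∈ (lineSum ℝ (Pe \ γ)).support) :
    linPair (castExp d) (irVector γ Pe) = 1 := by
  obtain ⟨e, he, rfl⟩ := exists_eq_single_of_mem_support_lineSum hd
  obtain ⟨hePe, heγ⟩ := Finset.mem_sdiff.1 he
  rw [irVector_eq, linPair_castExp_single_twoLevel, if_neg heγ, if_pos (Finset.mem_union_right _ hePe)]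
  norm_num

/-- `z_e = z_{e′} + z_{e″}`. [folklore] -/
private theorem lineSum_eq_inter_add_sdiff (Pe γ : Finset (Fin N)) :
    lineSum ℝ Pe = lineSum ℝ (Pe ∩ γ) + lineSum ℝ (Pe \ γ) := by
  unfold lineSum
  rw [← Finset.sum_sdiff (Finset.inter_subset_left (s₁ := Pe) (s₂ := γ)), Finset.sdiff_inter_self_left, add_comm]

/-- Every monomial of `V_{G′} V_{G/G′}` has `deg_γ = ℓ(γ)`. [cite: Brown2017, Prop. 2.2] -/
theorem sdeg_of_mem_support_kirchhoffSub_mul_kirchhoffQuot {γ : Finset (Fin N)} {d : Fin N →₀ ℕ}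
    (hd : d ∈ (kirchhoffSub E γ * kirchhoffQuot E γ).support) : ∑ e ∈ γ, d e = loopNumber E γ := by
  obtain ⟨a', ha', b', hb', rfl⟩ := exists_add_of_mem_support_mul hd
  simp only [Finsupp.add_apply, Finset.sum_add_distrib]
  rw [gammaDeg_of_mem_support_kirchhoffSub E ha', gammaDeg_of_mem_support_kirchhoffQuot E hb', add_zero]

/-- **UV for `V`**: every monomial of `V` has `deg_γ ≥ ℓ(γ)` (the companion's `card_sdiff_of_mem_support_kirchhoffPolynomial`, in `ℕ`). [cite: Brown2017, Prop. 2.2; Schultka2018, Proposition 4.11 (1)] -/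
theorem loopNumber_le_sdeg_of_mem_support_kirchhoffPolynomial (γ : Finset (Fin N)) {d : Fin N →₀ ℕ}
    (hd : d ∈ (kirchhoffPolynomial ℝ E).support) : loopNumber E γ ≤ ∑ e ∈ γ, d e := by
  have h := (card_sdiff_of_mem_support_kirchhoffPolynomial E hd γ).1
  rw [← Nat.cast_sum] at h
  exact_mod_cast h

/-- **UV for `V`, leading part**: the `deg_γ = ℓ(γ)` part of `V` is `V_{G′} V_{G/G′}` (Brown Prop. 2.2 first line, the
companion's `trunc_kirchhoffPolynomial_eq_kirchhoffSub_mul_kirchhoffQuot` in weight-part form). [cite: Brown2017, Prop. 2.2 (arXiv:1512.06409 §2.1); Schultka2018, Proposition 4.11 (1)] -/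
theorem weightPart_kirchhoffPolynomial_setIndicator_eq (hconn : IsConnectedEdgeList E) (γ : Finset (Fin N)) :
    weightPart (kirchhoffPolynomial ℝ E) (setIndicator γ) (loopNumber E γ) = kirchhoffSub E γ * kirchhoffQuot E γ := by
  refine weightPart_eq_of_remainder (fun d hd => ?_) (fun d hd => ?_)
  · rw [linPair_castExp_setIndicator, sdeg_of_mem_support_kirchhoffSub_mul_kirchhoffQuot E hd]
  · rw [← trunc_kirchhoffPolynomial_eq_kirchhoffSub_mul_kirchhoffQuot E hconn γ] at hd
    have h := remainder_gamma_degree E γ hd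
    rw [← Nat.cast_sum] at h
    rw [linPair_castExp_setIndicator]
    have h' : loopNumber E γ + 1 ≤ ∑ e ∈ γ, d e := by exact_mod_cast h
    rw [ne_eq, Nat.cast_inj]
    omega

/-- **The two lowest IR-weight parts of `V`**: for `k < 2`, `(V)_{2ℓ(γ)+k} = V_{G′} · (V_{G/G′})_k` — a 1-tree of weight `< 2ℓ + 2`
meets `γ` in a 1-tree of `G′` («доминирующее по степени δ дерево состоит из P₁, P₂ и любого 1-дерева G′» and the next group).
[cite: Volkov2016, §5.2 p.1175 (PDF p.12 L86–L88) and §5.3 (24) (PDF p.15 L56–L71); Brown2017, Prop. 2.2] -/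
theorem weightPart_kirchhoffPolynomial_irVector_of_lt_two (hconn : IsConnectedEdgeList E) (γ Pe : Finset (Fin N)) {k : ℝ}
    (hk : k < 2) :
    weightPart (kirchhoffPolynomial ℝ E) (irVector γ Pe) (2 * (loopNumber E γ : ℝ) + k) =
      subgraphPolynomial E γ * weightPart (quotientPolynomial E γ) (irVector γ Pe) k := by
  have hsplit : kirchhoffPolynomial ℝ E = kirchhoffSub E γ * kirchhoffQuot E γ +
      (kirchhoffPolynomial ℝ E - kirchhoffSub E γ * kirchhoffQuot E γ) := by ring
  have hR : weightPart (kirchhoffPolynomial ℝ E - kirchhoffSub E γ * kirchhoffQuot E γ)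
      (irVector γ Pe) (2 * (loopNumber E γ : ℝ) + k) = 0 := by
    refine weightPart_eq_zero fun d hd => ?_
    rw [← trunc_kirchhoffPolynomial_eq_kirchhoffSub_mul_kirchhoffQuot E hconn γ] at hd
    have h := remainder_gamma_degree E γ hd
    rw [← Nat.cast_sum] at h
    have h' : loopNumber E γ + 1 ≤ ∑ e ∈ γ, d e := by exact_mod_cast h
    have h5 : ∑ e ∈ γ, d e ≤ ∑ e ∈ γ ∪ Pe, d e := Finset.sum_le_sum_of_subset Finset.subset_union_left
    rw [linPair_castExp_irVector]
    have h6 : (2 * loopNumber E γ + 2 : ℝ) ≤ ((∑ e ∈ γ, d e + ∑ e ∈ γ ∪ Pe, d e : ℕ) : ℝ) := by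
      have : 2 * loopNumber E γ + 2 ≤ ∑ e ∈ γ, d e + ∑ e ∈ γ ∪ Pe, d e := by omega
      exact_mod_cast this
    intro heq
    rw [heq] at h6
    linarith
  rw [hsplit, weightPart_add, hR, add_zero, show 2 * (loopNumber E γ : ℝ) + k = 2 * (loopNumber E γ : ℝ) + k from rfl,
    weightPart_mul_left (fun d hd => by
      rw [linPair_castExp_irVector, gammaDeg_of_mem_support_kirchhoffSub E hd,
        sdeg_of_mem_support_kirchhoffSub_of_subset E Finset.subset_union_left hd]
      push_cast; ring),
    subgraphPolynomial_eq_kirchhoffSub, quotientPolynomial_eq_kirchhoffQuot]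

/-- **(25) FOR `W`, GRADED FORM.** Under the hypotheses of `weightPart_twoTreePolynomial_irVector`, the weight-`(2ℓ(γ)+2)` part of
Volkov's `W = S − V·z_e` along the IR vector is `V_{G′} · (W_{G/G′})₂ + W_{G′} · (V_{G/G′})₀` — the polynomial identity behind
«W/V ∼ W_{G′}/V_{G′} + W_{G/G′}/V_{G/G′}» (multiply (25) by `V ∼ V_{G′}V_{G/G′}`, (24)). For EVERY connected edge list and all
`γ, Pe, u, w, a, b` with `ℓ(γ ∪ Pe) = ℓ(γ)`, `a ~_γ b`, `u ~_{Pe∖γ} a`, `b ~_{Pe∖γ} w`; no sign, bridge or witness hypothesis.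
[cite: Volkov2016, §5.3 (25) (p.1177, PDF p.15 L85–L91) with (24) (PDF p.15 L56–L71)] -/
theorem weightPart_wPolynomial_irVector (hconn : IsConnectedEdgeList E)
    (hℓ : loopNumber E (γ ∪ Pe) = loopNumber E γ) (hγab : (edgeGraph E γ).Reachable a b)
    (hPa : (edgeGraph E (Pe \ γ)).Reachable u a) (hPb : (edgeGraph E (Pe \ γ)).Reachable b w) :
    weightPart (wPolynomial ℝ E u w Pe) (irVector γ Pe)
        (2 * (loopNumber E γ : ℝ) + 2) =
      subgraphPolynomial E γ *
          weightPart (wPolynomialQuot E γ u w Pe) (irVector γ Pe) 2 +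
        wPolynomialSub E γ a b Pe *
          weightPart (quotientPolynomial E γ) (irVector γ Pe) 0 := by
  set β : Fin N → ℝ := irVector γ Pe with hβ
  have hS := weightPart_twoTreePolynomial_irVector E hconn hℓ hγab hPa hPb
  have hV0 := weightPart_kirchhoffPolynomial_irVector_of_lt_two E hconn γ Pe (k := 0) (by norm_num)
  have hV1 := weightPart_kirchhoffPolynomial_irVector_of_lt_two E hconn γ Pe (k := 1) (by norm_num)
  rw [add_zero] at hV0
  -- the `V·z_e` part, split by the weight of the electron line
  have hVz : weightPart (kirchhoffPolynomial ℝ E * lineSum ℝ Pe) β (2 * (loopNumber E γ : ℝ) + 2) =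
      subgraphPolynomial E γ * weightPart (quotientPolynomial E γ) β 0 * lineSum ℝ (Pe ∩ γ) +
        subgraphPolynomial E γ * weightPart (quotientPolynomial E γ) β 1 * lineSum ℝ (Pe \ γ) := by
    rw [lineSum_eq_inter_add_sdiff Pe γ, mul_add, weightPart_add]
    congr 1
    · rw [weightPart_mul_right (fun d hd => linPair_of_mem_support_lineSum_inter hd), hV0]
    · rw [show 2 * (loopNumber E γ : ℝ) + 2 = (2 * (loopNumber E γ : ℝ) + 1) + 1 by ring,
        weightPart_mul_right (fun d hd => linPair_of_mem_support_lineSum_sdiff hd), hV1]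
  have hq : weightPart (quotientPolynomial E γ * lineSum ℝ (Pe \ γ)) β 2 =
      weightPart (quotientPolynomial E γ) β 1 * lineSum ℝ (Pe \ γ) := by
    rw [show (2 : ℝ) = 1 + 1 by norm_num, weightPart_mul_right (fun d hd => linPair_of_mem_support_lineSum_sdiff hd)]
  rw [wPolynomial, weightPart_sub, hS, hVz, wPolynomialQuot, weightPart_sub, hq, wPolynomialSub]
  ring

end OnShell

/-! ## §8 (25) AS PRINTED: along `z_l = c_l δ^{β_l}` the `δ²`-coefficients of `W/V`, `W_{G′}/V_{G′}`, `W_{G/G′}/V_{G/G′}` ADD, and the ratio of the two sides tends to `1`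

Orders along the IR vector: `ord V = 2ℓ(γ)` with `in_β V = V_{G′}·V_{G/(G′∪P₁∪P₂)}` (the companion's (24) plus the exact value);
`ord V_{G/G′} = 0` with `in_β V_{G/G′} = V_{G/(G′∪P₁∪P₂)}`; `V_{G′}`, `W_{G′}` homogeneous of weights `2ℓ`, `2ℓ+2`;
`(W_{G/G′})₀ = 0` always and `(W_{G/G′})₁ = 0` exactly when `(W)_{2ℓ+1} = 0` — in particular under the companion
`OnShellDenominatorRayOrder`'s «W/V ≍ δ²» (`ord W = ord V + 2`, its hypotheses (H1)–(H5) or its two QED witnesses). Then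
`δ^{−2}W/V → L`, `δ^{−2}W_{G′}/V_{G′} ≡ L₁`, `δ^{−2}W_{G/G′}/V_{G/G′} → L₂` with `L = L₁ + L₂` (§7 evaluated at `c`), and
`(W/V)/(W_{G′}/V_{G′} + W_{G/G′}/V_{G/G′}) → 1` — footnote 16's «∼» — since `L < 0`. -/

section Asymptotics

variable {N V : ℕ} (E : Fin N → Fin (V + 1) × Fin (V + 1))
variable {γ Pe : Finset (Fin N)} {u w a b : Fin (V + 1)}

/-- **`(V_{G/G′})₀ = V_{G/(G′∪P₁∪P₂)}`**: the weight-`0` part of `V_{G/G′}` along the IR vector (its 1-trees containing all of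
`P₁ ∪ P₂`) is the 1-tree polynomial of the quotient by `γ ∪ Pe` (conversion (b)). [cite: Volkov2016, §5.2 p.1175 (PDF p.12 L86–L88) and §5.3 (24); Oxley2011, §3.1 Prop. 3.1.7] -/
theorem weightPart_quotientPolynomial_irVector_zero (hℓ : loopNumber E (γ ∪ Pe) = loopNumber E γ) :
    weightPart (quotientPolynomial E γ) (irVector γ Pe) 0 = quotientPolynomial E (γ ∪ Pe) := by
  rw [quotientPolynomial_eq_kirchhoffQuot, quotientPolynomial_eq_kirchhoffQuot,
    ← weightPart_kirchhoffQuot_setIndicator_zero E (edgeRank_union_eq_of_loopNumber_eq E hℓ)]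
  refine weightPart_congr fun d hd => ?_
  have h0 := gammaDeg_of_mem_support_kirchhoffQuot E hd
  rw [linPair_castExp_setIndicator, linPair_castExp_irVector, Nat.cast_eq_zero, Nat.cast_eq_zero, sdeg_union_eq, h0]
  omega

/-- **`ord V_{G/G′} = 0` and `in_β V_{G/G′} = V_{G/(G′∪P₁∪P₂)}`** along the IR vector, when `ℓ(γ ∪ Pe) = ℓ(γ)`.
[cite: Volkov2016, §5.3 (24)–(25) (PDF p.15 L56–L91) with App. A (p.1185)] -/
theorem rayOrder_quotientPolynomial_irVector (hℓ : loopNumber E (γ ∪ Pe) = loopNumber E γ) :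
    rayOrder (quotientPolynomial E γ) (irVector γ Pe) = 0 ∧
      initForm (quotientPolynomial E γ) (irVector γ Pe) = quotientPolynomial E (γ ∪ Pe) := by
  have h := rayOrder_eq_of_forall_le_of_weightPart_ne_zero (R := quotientPolynomial E γ) (β := irVector γ Pe) (k := 0)
    (fun d _ => by rw [linPair_castExp_irVector]; exact Nat.cast_nonneg _)
    (by rw [weightPart_quotientPolynomial_irVector_zero E hℓ, quotientPolynomial_eq_kirchhoffQuot]
        exact kirchhoffQuot_ne_zero E _)
  rwa [weightPart_quotientPolynomial_irVector_zero E hℓ] at h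

/-- Every monomial of `V` has IR weight `≥ 2ℓ(γ)` («V ≍ δ^{N_{G′}−1}», lower-bound half: `deg_γ ≥ ℓ`, `deg_{γ∪Pe} ≥ deg_γ`).
[cite: Volkov2016, §5.2 p.1175 (PDF p.12 L86–L88); Brown2017, Prop. 2.2] -/
theorem two_mul_loopNumber_le_linPair_of_mem_support_kirchhoffPolynomial (γ Pe : Finset (Fin N)) {d : Fin N →₀ ℕ}
    (hd : d ∈ (kirchhoffPolynomial ℝ E).support) : 2 * (loopNumber E γ : ℝ) ≤ linPair (castExp d) (irVector γ Pe) := by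
  have h1 := loopNumber_le_sdeg_of_mem_support_kirchhoffPolynomial E γ hd
  have h5 : ∑ e ∈ γ, d e ≤ ∑ e ∈ γ ∪ Pe, d e := Finset.sum_le_sum_of_subset Finset.subset_union_left
  rw [linPair_castExp_irVector]
  have : 2 * loopNumber E γ ≤ ∑ e ∈ γ, d e + ∑ e ∈ γ ∪ Pe, d e := by omega
  exact_mod_cast this

/-- **`ord V = 2ℓ(γ)` and `in_β V = V_{G′} · V_{G/(G′∪P₁∪P₂)}` along the IR vector** — the companion
`OneTreePolynomialRayOrder`'s «V ≍ δ^{N_{G′}−1}» with the companion `OneTreePolynomialQuotientFactorization`'s (24)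
`in_β V = in_β(V_{G′}V_{G/G′})`, now with the second factor in closed form; hypothesis `ℓ(γ ∪ Pe) = ℓ(γ)` only.
[cite: Volkov2016, §5.2 p.1175 (PDF p.12 L86–L88: «V ≍ δ^{N_{G′}−1} (доминирующее по степени δ дерево состоит из P₁, P₂ и любого 1-дерева G′)») and §5.3 (24) (PDF p.15 L56–L71)] -/
theorem rayOrder_kirchhoffPolynomial_irVector_eq (hconn : IsConnectedEdgeList E) (hℓ : loopNumber E (γ ∪ Pe) = loopNumber E γ) :
    rayOrder (kirchhoffPolynomial ℝ E) (irVector γ Pe) = 2 * (loopNumber E γ : ℝ) ∧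
      initForm (kirchhoffPolynomial ℝ E) (irVector γ Pe) = subgraphPolynomial E γ * quotientPolynomial E (γ ∪ Pe) := by
  have hV0 := weightPart_kirchhoffPolynomial_irVector_of_lt_two E hconn γ Pe (k := 0) (by norm_num)
  rw [add_zero, weightPart_quotientPolynomial_irVector_zero E hℓ] at hV0
  have h := rayOrder_eq_of_forall_le_of_weightPart_ne_zero (R := kirchhoffPolynomial ℝ E) (β := irVector γ Pe)
    (k := 2 * (loopNumber E γ : ℝ)) (fun d hd => two_mul_loopNumber_le_linPair_of_mem_support_kirchhoffPolynomial E γ Pe hd)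
    (by rw [hV0, subgraphPolynomial_eq_kirchhoffSub, quotientPolynomial_eq_kirchhoffQuot]
        exact mul_ne_zero (kirchhoffSub_ne_zero E γ) (kirchhoffQuot_ne_zero E _))
  rwa [hV0] at h

/-- `V_{G′}` is homogeneous of IR weight `2ℓ(γ)`. [cite: Volkov2016, §5.3 p.1177 (PDF p.14 L21–L31); Brown2017, Prop. 2.2 ("deg Ψ_γ = h_γ")] -/
theorem linPair_of_mem_support_subgraphPolynomial {d : Fin N →₀ ℕ} (hd : d ∈ (subgraphPolynomial E γ).support) :
    linPair (castExp d) (irVector γ Pe) = 2 * (loopNumber E γ : ℝ) := by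
  rw [subgraphPolynomial_eq_kirchhoffSub] at hd
  rw [linPair_castExp_irVector, gammaDeg_of_mem_support_kirchhoffSub E hd,
    sdeg_of_mem_support_kirchhoffSub_of_subset E Finset.subset_union_left hd]
  push_cast
  ring

/-- `S_{G′}` is homogeneous of IR weight `2ℓ(γ) + 2`. [cite: Volkov2016, §5.3 p.1177 (PDF p.14 L21–L31); Brown2017, Prop. 2.4 ("deg Φ_γ = h_γ + 1")] -/
theorem linPair_of_mem_support_twoTreePolynomialSub {d : Fin N →₀ ℕ} (hd : d ∈ (twoTreePolynomialSub E γ a b).support) :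
    linPair (castExp d) (irVector γ Pe) = 2 * (loopNumber E γ : ℝ) + 2 := by
  unfold twoTreePolynomialSub at hd
  obtain ⟨F', hF', hdF⟩ := Finset.mem_biUnion.1 (support_sum hd)
  obtain ⟨hF'γ, -, hcard, -⟩ := Finset.mem_filter.1 hF'
  rw [Finset.mem_powerset] at hF'γ
  have hrk : edgeRank E γ ≤ γ.card := edgeRank_le_card E γ
  rw [linPair_castExp_irVector, sdeg_of_mem_support_prod_X γ _ hdF, sdeg_of_mem_support_prod_X (γ ∪ Pe) _ hdF,
    Finset.inter_eq_right.2 Finset.sdiff_subset, Finset.inter_eq_right.2 (Finset.sdiff_subset.trans Finset.subset_union_left),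
    Finset.card_sdiff_of_subset hF'γ, loopNumber]
  have := Finset.card_le_card hF'γ
  have h2 : ((γ.card - F'.card + (γ.card - F'.card) : ℕ) : ℝ) = 2 * ((γ.card - edgeRank E γ : ℕ) : ℝ) + 2 := by
    have : γ.card - F'.card + (γ.card - F'.card) = 2 * (γ.card - edgeRank E γ) + 2 := by omega
    rw [this]; push_cast; ring
  exact h2

/-- `W_{G′}` is homogeneous of IR weight `2ℓ(γ) + 2`. [cite: Volkov2016, §5.3 p.1177 (PDF p.14 L21–L31)] -/
theorem linPair_of_mem_support_wPolynomialSub {d : Fin N →₀ ℕ} (hd : d ∈ (wPolynomialSub E γ a b Pe).support) :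
    linPair (castExp d) (irVector γ Pe) = 2 * (loopNumber E γ : ℝ) + 2 := by
  unfold wPolynomialSub at hd
  have hcases : d ∈ (twoTreePolynomialSub E γ a b).support ∨
      d ∈ (subgraphPolynomial E γ * lineSum ℝ (Pe ∩ γ)).support := by
    by_contra hn
    push Not at hn
    rw [mem_support_iff, coeff_sub, notMem_support_iff.1 hn.1, notMem_support_iff.1 hn.2, sub_zero] at hd
    exact hd rfl
  rcases hcases with h | h
  · exact linPair_of_mem_support_twoTreePolynomialSub E h
  · obtain ⟨a', ha', b', hb', rfl⟩ := exists_add_of_mem_support_mul h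
    rw [castExp_add', linPair_add_left', linPair_of_mem_support_subgraphPolynomial E ha',
      linPair_of_mem_support_lineSum_inter hb']

/-- **`(W_{G/G′})₀ = 0`**: a 2-tree of `G/G′` containing all of `P₁ ∪ P₂` does not separate `u` from `w` (they are joined through
`P₁`, `G′`, `P₂`), and `V_{G/G′}·z_{e″}` has weight `≥ 1`. [cite: Volkov2016, §5.2 p.1176–1177 (PDF p.13 L106–L113) for G/G′] -/
theorem weightPart_wPolynomialQuot_irVector_zero (hγab : (edgeGraph E γ).Reachable a b)
    (hPa : (edgeGraph E (Pe \ γ)).Reachable u a) (hPb : (edgeGraph E (Pe \ γ)).Reachable b w) :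
    weightPart (wPolynomialQuot E γ u w Pe) (irVector γ Pe) 0 = 0 := by
  have huw := reachable_union_of_paths E hγab hPa hPb
  have hS : weightPart (twoTreePolynomialQuot E γ u w) (irVector γ Pe) 0 = 0 := by
    unfold twoTreePolynomialQuot
    rw [weightPart_sum]
    refine Finset.sum_eq_zero fun T' hT' => weightPart_eq_zero fun d hd h0 => ?_
    obtain ⟨hT'c, -, -, hsep⟩ := Finset.mem_filter.1 hT'
    rw [linPair_castExp_irVector, Nat.cast_eq_zero, sdeg_of_mem_support_prod_X γ _ hd,
      sdeg_of_mem_support_prod_X (γ ∪ Pe) _ hd] at h0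
    have hP : Pe \ γ ⊆ T' := by
      intro e he
      obtain ⟨hePe, heγ⟩ := Finset.mem_sdiff.1 he
      by_contra heT
      have hmem : e ∈ (γ ∪ Pe) ∩ (γᶜ \ T') :=
        Finset.mem_inter.2 ⟨Finset.mem_union_right _ hePe, Finset.mem_sdiff.2 ⟨Finset.mem_compl.2 heγ, heT⟩⟩
      rw [Finset.card_eq_zero.1 (by omega : ((γ ∪ Pe) ∩ (γᶜ \ T')).card = 0)] at hmem
      exact Finset.notMem_empty e hmem
    have hsub : γ ∪ Pe ⊆ γ ∪ T' := by
      rw [← Finset.union_sdiff_self_eq_union]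
      exact Finset.union_subset_union (Finset.Subset.refl _) hP
    exact hsep (huw.mono (edgeGraph_mono hsub))
  have hVz : weightPart (quotientPolynomial E γ * lineSum ℝ (Pe \ γ)) (irVector γ Pe) 0 = 0 := by
    refine weightPart_eq_zero fun d hd h0 => ?_
    obtain ⟨a', -, b', hb', rfl⟩ := exists_add_of_mem_support_mul hd
    rw [castExp_add', linPair_add_left', linPair_of_mem_support_lineSum_sdiff hb', linPair_castExp_irVector] at h0
    have : (0 : ℝ) ≤ ((∑ e ∈ γ, a' e + ∑ e ∈ γ ∪ Pe, a' e : ℕ) : ℝ) := Nat.cast_nonneg _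
    linarith
  rw [wPolynomialQuot, weightPart_sub, hS, hVz, sub_zero]

/-- **The weight-`(2ℓ+1)` part of `S` is `V_{G′}·(S_{G/G′})₁`** (the only class at this weight is Brown's UV class with one
`P`-chord). [cite: Volkov2016, §5.2 p.1176–1177 (PDF p.13 L106–L113); Brown2017, Prop. 2.2 and Prop. 2.4] -/
theorem weightPart_twoTreePolynomial_irVector_succ (hconn : IsConnectedEdgeList E) (hℓ : loopNumber E (γ ∪ Pe) = loopNumber E γ)
    (huw : (edgeGraph E (γ ∪ Pe)).Reachable u w) :
    weightPart (twoTreePolynomial ℝ E u w) (irVector γ Pe) (2 * (loopNumber E γ : ℝ) + 1) =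
      subgraphPolynomial E γ * weightPart (twoTreePolynomialQuot E γ u w) (irVector γ Pe) 1 := by
  have hS2 := weightPart_twoTreePolynomial_setIndicator_eq E hconn γ (u := u) (w := w)
  have hA : weightPart (twoTreePolynomial ℝ E u w) (irVector γ Pe) (2 * (loopNumber E γ : ℝ) + 1) =
      weightPart (weightPart (twoTreePolynomial ℝ E u w) (setIndicator γ) (loopNumber E γ)) (setIndicator (γ ∪ Pe))
        ((loopNumber E γ : ℝ) + 1) := by
    ext d
    simp only [coeff_weightPart, linPair_castExp_irVector, linPair_castExp_setIndicator]
    by_cases hd : coeff d (twoTreePolynomial ℝ E u w) = 0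
    · simp [hd]
    · have hdS : d ∈ (twoTreePolynomial ℝ E u w).support := mem_support_iff.2 hd
      have h1 := loopNumber_le_sdeg_of_mem_support_twoTreePolynomial E hconn γ hdS
      have h3 : loopNumber E γ + 1 ≤ ∑ e ∈ γ ∪ Pe, d e := by
        have h3' := loopNumber_succ_le_sdeg_of_mem_support_twoTreePolynomial E hconn huw hdS
        rwa [hℓ] at h3'
      have c0 : ((∑ e ∈ γ, d e + ∑ e ∈ γ ∪ Pe, d e : ℕ) : ℝ) = 2 * (loopNumber E γ : ℝ) + 1 ↔
          ∑ e ∈ γ, d e + ∑ e ∈ γ ∪ Pe, d e = 2 * loopNumber E γ + 1 := by norm_cast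
      have c1 : ((∑ e ∈ γ ∪ Pe, d e : ℕ) : ℝ) = (loopNumber E γ : ℝ) + 1 ↔ ∑ e ∈ γ ∪ Pe, d e = loopNumber E γ + 1 := by
        norm_cast
      have c2 : ((∑ e ∈ γ, d e : ℕ) : ℝ) = (loopNumber E γ : ℝ) ↔ ∑ e ∈ γ, d e = loopNumber E γ := by norm_cast
      simp only [c0, c1, c2]
      by_cases e0 : ∑ e ∈ γ, d e + ∑ e ∈ γ ∪ Pe, d e = 2 * loopNumber E γ + 1
      · have e1 : ∑ e ∈ γ ∪ Pe, d e = loopNumber E γ + 1 := by omega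
        have e2 : ∑ e ∈ γ, d e = loopNumber E γ := by omega
        rw [if_pos e0, if_pos e1, if_pos e2]
      · rw [if_neg e0]
        by_cases e1 : ∑ e ∈ γ ∪ Pe, d e = loopNumber E γ + 1
        · have e2 : ¬ ∑ e ∈ γ, d e = loopNumber E γ := by omega
          rw [if_pos e1, if_neg e2]
        · rw [if_neg e1]
  rw [hA, hS2, weightPart_mul_left (fun d hd => by
      rw [linPair_castExp_setIndicator, sdeg_of_mem_support_kirchhoffSub_of_subset E Finset.subset_union_left hd]),
    subgraphPolynomial_eq_kirchhoffSub, twoTreePolynomialQuot_eq_secondSymanzikQuot]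
  congr 1
  refine weightPart_congr fun d hd => ?_
  rw [linPair_castExp_setIndicator, linPair_castExp_irVector, gammaDeg_of_mem_support_secondSymanzikQuot E hd, zero_add]

/-- **`(W)_{2ℓ+1} = V_{G′} · (W_{G/G′})₁`**: the next-to-leading cancellation of §5.2 («все вклады пар (T; l) для доминирующих
по степени δ деревьев T … сократятся») happens inside `G/G′`. [cite: Volkov2016, §5.2 p.1176–1177 (PDF p.13 L106–L113, p.14 L1–L3) and §5.3 (25)] -/
theorem weightPart_wPolynomial_irVector_succ (hconn : IsConnectedEdgeList E) (hℓ : loopNumber E (γ ∪ Pe) = loopNumber E γ)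
    (hγab : (edgeGraph E γ).Reachable a b) (hPa : (edgeGraph E (Pe \ γ)).Reachable u a)
    (hPb : (edgeGraph E (Pe \ γ)).Reachable b w) :
    weightPart (wPolynomial ℝ E u w Pe) (irVector γ Pe) (2 * (loopNumber E γ : ℝ) + 1) =
      subgraphPolynomial E γ * weightPart (wPolynomialQuot E γ u w Pe) (irVector γ Pe) 1 := by
  have huw := reachable_union_of_paths E hγab hPa hPb
  have hS := weightPart_twoTreePolynomial_irVector_succ E hconn hℓ huw
  have hV0 := weightPart_kirchhoffPolynomial_irVector_of_lt_two E hconn γ Pe (k := 0) (by norm_num)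
  rw [add_zero] at hV0
  have hVm : weightPart (kirchhoffPolynomial ℝ E) (irVector γ Pe) (2 * (loopNumber E γ : ℝ) - 1) = 0 :=
    weightPart_eq_zero fun d hd h => by
      have := two_mul_loopNumber_le_linPair_of_mem_support_kirchhoffPolynomial E γ Pe hd
      linarith
  have hVz : weightPart (kirchhoffPolynomial ℝ E * lineSum ℝ Pe) (irVector γ Pe) (2 * (loopNumber E γ : ℝ) + 1) =
      subgraphPolynomial E γ * weightPart (quotientPolynomial E γ) (irVector γ Pe) 0 * lineSum ℝ (Pe \ γ) := by
    rw [lineSum_eq_inter_add_sdiff Pe γ, mul_add, weightPart_add,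
      show 2 * (loopNumber E γ : ℝ) + 1 = (2 * (loopNumber E γ : ℝ) - 1) + 2 by ring,
      weightPart_mul_right (fun d hd => linPair_of_mem_support_lineSum_inter hd), hVm, zero_mul, zero_add,
      show 2 * (loopNumber E γ : ℝ) - 1 + 2 = 2 * (loopNumber E γ : ℝ) + 1 by ring,
      weightPart_mul_right (fun d hd => linPair_of_mem_support_lineSum_sdiff hd), hV0]
  have hq : weightPart (quotientPolynomial E γ * lineSum ℝ (Pe \ γ)) (irVector γ Pe) 1 =
      weightPart (quotientPolynomial E γ) (irVector γ Pe) 0 * lineSum ℝ (Pe \ γ) := by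
    rw [show (1 : ℝ) = 0 + 1 by norm_num, weightPart_mul_right (fun d hd => linPair_of_mem_support_lineSum_sdiff hd)]
  rw [wPolynomial, weightPart_sub, hS, hVz, wPolynomialQuot, weightPart_sub, hq]
  ring

/-- **Under «W/V ≍ δ²» the quotient block has IR weights `≥ 2`**: if `(W)_{2ℓ+1} = 0` (e.g. `ord W = ord V + 2`, the companion
`OnShellDenominatorRayOrder`), then every monomial of `W_{G/G′}` has weight `≥ 2` along the IR vector. [cite: Volkov2016, §5.2 p.1176 (PDF p.13 L29 «W/V ≍ δ²») and §5.3 (25)] -/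
theorem two_le_linPair_of_mem_support_wPolynomialQuot (hconn : IsConnectedEdgeList E)
    (hℓ : loopNumber E (γ ∪ Pe) = loopNumber E γ) (hγab : (edgeGraph E γ).Reachable a b)
    (hPa : (edgeGraph E (Pe \ γ)).Reachable u a) (hPb : (edgeGraph E (Pe \ γ)).Reachable b w)
    (hW1 : weightPart (wPolynomial ℝ E u w Pe) (irVector γ Pe) (2 * (loopNumber E γ : ℝ) + 1) = 0)
    {d : Fin N →₀ ℕ} (hd : d ∈ (wPolynomialQuot E γ u w Pe).support) : 2 ≤ linPair (castExp d) (irVector γ Pe) := by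
  have h0 := weightPart_wPolynomialQuot_irVector_zero E hγab hPa hPb (Pe := Pe)
  have h1 : weightPart (wPolynomialQuot E γ u w Pe) (irVector γ Pe) 1 = 0 := by
    rw [weightPart_wPolynomial_irVector_succ E hconn hℓ hγab hPa hPb, subgraphPolynomial_eq_kirchhoffSub] at hW1
    exact (mul_eq_zero.1 hW1).resolve_left (kirchhoffSub_ne_zero E γ)
  rw [linPair_castExp_irVector]
  have hc : coeff d (wPolynomialQuot E γ u w Pe) ≠ 0 := mem_support_iff.1 hd
  by_contra hlt
  push Not at hlt
  have hlt' : ∑ e ∈ γ, d e + ∑ e ∈ γ ∪ Pe, d e < 2 := by exact_mod_cast hlt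
  rcases Nat.lt_succ_iff_lt_or_eq.1 hlt' with h | h
  · have h' : ∑ e ∈ γ, d e + ∑ e ∈ γ ∪ Pe, d e = 0 := by omega
    have := congrArg (coeff d) h0
    rw [coeff_weightPart, linPair_castExp_irVector, h', coeff_zero, Nat.cast_zero, if_pos rfl] at this
    exact hc this
  · have := congrArg (coeff d) h1
    rw [coeff_weightPart, linPair_castExp_irVector, h, coeff_zero, Nat.cast_one, if_pos rfl] at this
    exact hc this

/-- `ord W = ord V + 2` along the IR vector makes `(W)_{2ℓ+1}` vanish and identifies `in_β W` with `(W)_{2ℓ+2}`.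
[cite: Volkov2016, §5.2 p.1176 (PDF p.13 L29 «W/V ≍ δ²») with App. A (p.1185)] -/
theorem initForm_wPolynomial_irVector_eq (hconn : IsConnectedEdgeList E) (hℓ : loopNumber E (γ ∪ Pe) = loopNumber E γ)
    (h : rayOrder (wPolynomial ℝ E u w Pe) (irVector γ Pe) = rayOrder (kirchhoffPolynomial ℝ E) (irVector γ Pe) + 2) :
    weightPart (wPolynomial ℝ E u w Pe) (irVector γ Pe) (2 * (loopNumber E γ : ℝ) + 1) = 0 ∧
      initForm (wPolynomial ℝ E u w Pe) (irVector γ Pe) =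
        weightPart (wPolynomial ℝ E u w Pe) (irVector γ Pe) (2 * (loopNumber E γ : ℝ) + 2) := by
  rw [(rayOrder_kirchhoffPolynomial_irVector_eq E hconn hℓ).1] at h
  refine ⟨weightPart_eq_zero_of_lt_rayOrder (by rw [h]; linarith), ?_⟩
  rw [initForm_eq_weightPart, h]

/-- **«W_{G′}/V_{G′}» along the ray is EXACTLY `δ² · W_{G′}(c)/V_{G′}(c)`** (both homogeneous). [cite: Volkov2016, §5.3 (25) (PDF p.15 L85–L87) with §5.1 (19)] -/
theorem wPolynomialSub_div_rayPath (x : Fin N → ℝ) {δ : ℝ} (hδ : 0 < δ) :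
    eval (rayPath x (irVector γ Pe) δ) (wPolynomialSub E γ a b Pe) / eval (rayPath x (irVector γ Pe) δ) (subgraphPolynomial E γ) =
      δ ^ (2 : ℝ) * (eval x (wPolynomialSub E γ a b Pe) / eval x (subgraphPolynomial E γ)) := by
  rw [eval_rayPath_of_forall_eq _ _ x (fun d hd => linPair_of_mem_support_wPolynomialSub E hd) hδ,
    eval_rayPath_of_forall_eq _ _ x (fun d hd => linPair_of_mem_support_subgraphPolynomial E (Pe := Pe) hd) hδ,
    Real.rpow_add hδ, mul_div_mul_comm, mul_div_cancel_left₀ _ (Real.rpow_pos_of_pos hδ _).ne']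

/-- `V_{G′}(c) > 0` on the open positive orthant. [cite: Volkov2016, §5.2 footnote 16 (PDF p.12 L97–L99)] -/
theorem eval_subgraphPolynomial_pos {x : Fin N → ℝ} (hx : ∀ i, 0 < x i) : 0 < eval x (subgraphPolynomial E γ) := by
  have hhom : ∀ d ∈ (subgraphPolynomial E γ).support, linPair (castExp d) (irVector γ γ) = 2 * (loopNumber E γ : ℝ) :=
    fun d hd => linPair_of_mem_support_subgraphPolynomial E hd
  have h := eval_initForm_basisPolynomial_pos (cycleMatroid E ↾ (γ : Set (Fin N))) (irVector γ γ) hx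
  rw [basisPolynomial_restrict_cycleMatroid, initForm_eq_weightPart,
    (rayOrder_eq_of_forall_le_of_weightPart_ne_zero (R := subgraphPolynomial E γ) (β := irVector γ γ)
      (k := 2 * (loopNumber E γ : ℝ)) (fun d hd => (hhom d hd).ge)
      (by rw [weightPart_eq_self hhom, subgraphPolynomial_eq_kirchhoffSub]; exact kirchhoffSub_ne_zero E γ)).1,
    weightPart_eq_self hhom] at h
  exact h

/-- `V_{G/(G′∪P)}(c) > 0` on the open positive orthant. [cite: Volkov2016, §5.2 footnote 16 (PDF p.12 L97–L99)] -/
theorem eval_weightPart_quotientPolynomial_pos (hℓ : loopNumber E (γ ∪ Pe) = loopNumber E γ) {x : Fin N → ℝ}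
    (hx : ∀ i, 0 < x i) : 0 < eval x (weightPart (quotientPolynomial E γ) (irVector γ Pe) 0) := by
  rw [← (rayOrder_quotientPolynomial_irVector E hℓ).2.trans (weightPart_quotientPolynomial_irVector_zero E hℓ).symm,
    ← basisPolynomial_contract_cycleMatroid]
  exact eval_initForm_basisPolynomial_pos _ _ hx

/-- **«W_{G/G′}/V_{G/G′}»: `δ^{−2} · W_{G/G′}(z(δ))/V_{G/G′}(z(δ)) → (W_{G/G′})₂(c)/(V_{G/G′})₀(c)`** as `δ → 0⁺`, whenever
`(W)_{2ℓ+1} = 0`. [cite: Volkov2016, §5.3 (25) (PDF p.15 L85–L87) with footnote 16 and App. A (p.1185)] -/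
theorem tendsto_wPolynomialQuot_div (hconn : IsConnectedEdgeList E) (hℓ : loopNumber E (γ ∪ Pe) = loopNumber E γ)
    (hγab : (edgeGraph E γ).Reachable a b) (hPa : (edgeGraph E (Pe \ γ)).Reachable u a)
    (hPb : (edgeGraph E (Pe \ γ)).Reachable b w)
    (hW1 : weightPart (wPolynomial ℝ E u w Pe) (irVector γ Pe) (2 * (loopNumber E γ : ℝ) + 1) = 0)
    {x : Fin N → ℝ} (hx : ∀ i, 0 < x i) :
    Tendsto (fun δ : ℝ => δ ^ (-(2 : ℝ)) *
        (eval (rayPath x (irVector γ Pe) δ) (wPolynomialQuot E γ u w Pe) /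
          eval (rayPath x (irVector γ Pe) δ) (quotientPolynomial E γ)))
      (𝓝[>] 0) (𝓝 (eval x (weightPart (wPolynomialQuot E γ u w Pe) (irVector γ Pe) 2) /
        eval x (weightPart (quotientPolynomial E γ) (irVector γ Pe) 0))) := by
  have hW := tendsto_rpow_neg_mul_eval_weightPart (wPolynomialQuot E γ u w Pe) (irVector γ Pe) x
    (fun d hd => two_le_linPair_of_mem_support_wPolynomialQuot E hconn hℓ hγab hPa hPb hW1 hd)
  have hV := tendsto_rpow_neg_mul_eval_weightPart (quotientPolynomial E γ) (irVector γ Pe) x (k := 0)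
    (fun d _ => by rw [linPair_castExp_irVector]; exact Nat.cast_nonneg _)
  have hpos := eval_weightPart_quotientPolynomial_pos E hℓ hx
  refine (tendsto_congr' ?_).1 (hW.div hV hpos.ne')
  filter_upwards [self_mem_nhdsWithin] with δ (hδ : 0 < δ)
  simp only [Pi.div_apply, neg_zero, Real.rpow_zero, one_mul]
  ring

/-- **(25): THE `δ²`-COEFFICIENTS ADD.** Under the §5.2 hypotheses in edge-list form and «W/V ≍ δ²» (`ord W = ord V + 2` along the
IR vector — the companion `OnShellDenominatorRayOrder`'s `rayOrder_wPolynomial_eq_of_inner_cycle` / `_of_outer_line`), the limit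
`L = lim δ^{−2} W/V = W_β(c)/V_β(c)` (the companion's `tendsto_wPolynomial_div_kirchhoffPolynomial`) is the SUM of
`L₁ = W_{G′}(c)/V_{G′}(c)` (`= δ^{−2}W_{G′}/V_{G′}` identically) and `L₂ = lim δ^{−2} W_{G/G′}/V_{G/G′}`.
[cite: Volkov2016, §5.3 (25) (p.1177, PDF p.15 L85–L87) with footnote 16 (PDF p.12 L97–L99)] -/
theorem div_eval_initForm_eq_add (hconn : IsConnectedEdgeList E) (hℓ : loopNumber E (γ ∪ Pe) = loopNumber E γ)
    (hγab : (edgeGraph E γ).Reachable a b) (hPa : (edgeGraph E (Pe \ γ)).Reachable u a)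
    (hPb : (edgeGraph E (Pe \ γ)).Reachable b w)
    (h : rayOrder (wPolynomial ℝ E u w Pe) (irVector γ Pe) = rayOrder (kirchhoffPolynomial ℝ E) (irVector γ Pe) + 2)
    {x : Fin N → ℝ} (hx : ∀ i, 0 < x i) :
    eval x (initForm (wPolynomial ℝ E u w Pe) (irVector γ Pe)) / eval x (initForm (kirchhoffPolynomial ℝ E) (irVector γ Pe)) =
      eval x (wPolynomialSub E γ a b Pe) / eval x (subgraphPolynomial E γ) +
        eval x (weightPart (wPolynomialQuot E γ u w Pe) (irVector γ Pe) 2) /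
          eval x (weightPart (quotientPolynomial E γ) (irVector γ Pe) 0) := by
  have hV := (rayOrder_kirchhoffPolynomial_irVector_eq E hconn hℓ).2
  have hW := (initForm_wPolynomial_irVector_eq E hconn hℓ h).2
  have hq0 := weightPart_quotientPolynomial_irVector_zero E hℓ
  have h1 : eval x (subgraphPolynomial E γ) ≠ 0 := (eval_subgraphPolynomial_pos E hx).ne'
  have h2 : eval x (weightPart (quotientPolynomial E γ) (irVector γ Pe) 0) ≠ 0 :=
    (eval_weightPart_quotientPolynomial_pos E hℓ hx).ne'
  rw [hW, weightPart_wPolynomial_irVector E hconn hℓ hγab hPa hPb, hV, ← hq0]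
  simp only [eval_add, eval_mul]
  field_simp
  ring

/-- **(25) AS PRINTED: «W/V ∼ W_{G′}/V_{G′} + W_{G/G′}/V_{G/G′}»** ⟦footnote 16: «f ∼ g означает lim f/g = 1»⟧ — along
`z_l = c_l δ^{β_l}` with `β` the IR vector of §5.2 and any `c_l > 0`, the ratio of `W/V` to `W_{G′}/V_{G′} + W_{G/G′}/V_{G/G′}`
tends to `1` as `δ → 0⁺`. Hypotheses: connected edge list; `ℓ(γ ∪ Pe) = ℓ(γ)`, `a ~_γ b`, `u ~_{Pe∖γ} a`, `b ~_{Pe∖γ} w`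
(§5.2's setting in edge-list form); «W/V ≍ δ²» as `ord W = ord V + 2` and `u ~_{Pe} w` (which makes the common limit negative,
hence non-zero — the companion's `div_eval_initForm_neg`). NOT CLAIMED: (24)'s `B`/`Q̂` relations, (26) and the circuit proof,
App. C's nested version, and that a given QED graph satisfies the hypotheses. [cite: Volkov2016, §5.3 (25) (p.1177, PDF p.15 L85–L91) with footnote 16 (p.1175, PDF p.12 L97–L99) and §5.2 p.1176 (PDF p.13 L29)] -/
theorem tendsto_wPolynomial_div_div_add (hconn : IsConnectedEdgeList E) (hℓ : loopNumber E (γ ∪ Pe) = loopNumber E γ)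
    (hγab : (edgeGraph E γ).Reachable a b) (hPa : (edgeGraph E (Pe \ γ)).Reachable u a)
    (hPb : (edgeGraph E (Pe \ γ)).Reachable b w) (hP : (edgeGraph E Pe).Reachable u w)
    (h : rayOrder (wPolynomial ℝ E u w Pe) (irVector γ Pe) = rayOrder (kirchhoffPolynomial ℝ E) (irVector γ Pe) + 2)
    {x : Fin N → ℝ} (hx : ∀ i, 0 < x i) :
    Tendsto (fun δ : ℝ =>
        (eval (rayPath x (irVector γ Pe) δ) (wPolynomial ℝ E u w Pe) / eval (rayPath x (irVector γ Pe) δ) (kirchhoffPolynomial ℝ E)) /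
          (eval (rayPath x (irVector γ Pe) δ) (wPolynomialSub E γ a b Pe) /
              eval (rayPath x (irVector γ Pe) δ) (subgraphPolynomial E γ) +
            eval (rayPath x (irVector γ Pe) δ) (wPolynomialQuot E γ u w Pe) /
              eval (rayPath x (irVector γ Pe) δ) (quotientPolynomial E γ)))
      (𝓝[>] 0) (𝓝 1) := by
  have hWne : wPolynomial ℝ E u w Pe ≠ 0 := by
    intro h0
    rw [h0, (rayOrder_kirchhoffPolynomial_irVector_eq E hconn hℓ).1] at h
    simp only [rayOrder, dif_pos] at h
    have : (0 : ℝ) ≤ loopNumber E γ := Nat.cast_nonneg _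
    linarith
  set L := eval x (initForm (wPolynomial ℝ E u w Pe) (irVector γ Pe)) /
    eval x (initForm (kirchhoffPolynomial ℝ E) (irVector γ Pe)) with hL
  set L₁ := eval x (wPolynomialSub E γ a b Pe) / eval x (subgraphPolynomial E γ) with hL₁
  set L₂ := eval x (weightPart (wPolynomialQuot E γ u w Pe) (irVector γ Pe) 2) /
    eval x (weightPart (quotientPolynomial E γ) (irVector γ Pe) 0) with hL₂
  have hsum : L = L₁ + L₂ := div_eval_initForm_eq_add E hconn hℓ hγab hPa hPb h hx
  have hLneg : L < 0 := div_eval_initForm_neg hconn hP hWne (irVector γ Pe) hx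
  have hA : Tendsto (fun δ : ℝ => δ ^ (-(2 : ℝ)) *
      (eval (rayPath x (irVector γ Pe) δ) (wPolynomial ℝ E u w Pe) /
        eval (rayPath x (irVector γ Pe) δ) (kirchhoffPolynomial ℝ E))) (𝓝[>] 0) (𝓝 L) :=
    tendsto_wPolynomial_div_kirchhoffPolynomial hconn h hx
  have hB : Tendsto (fun δ : ℝ => δ ^ (-(2 : ℝ)) *
      (eval (rayPath x (irVector γ Pe) δ) (wPolynomialSub E γ a b Pe) /
        eval (rayPath x (irVector γ Pe) δ) (subgraphPolynomial E γ))) (𝓝[>] 0) (𝓝 L₁) := by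
    refine (tendsto_congr' ?_).2 tendsto_const_nhds
    filter_upwards [self_mem_nhdsWithin] with δ (hδ : 0 < δ)
    rw [wPolynomialSub_div_rayPath E x hδ, ← mul_assoc, ← Real.rpow_add hδ, hL₁]
    norm_num
  have hC := tendsto_wPolynomialQuot_div E hconn hℓ hγab hPa hPb (initForm_wPolynomial_irVector_eq E hconn hℓ h).1 hx
  have hBC : Tendsto (fun δ : ℝ => δ ^ (-(2 : ℝ)) *
      (eval (rayPath x (irVector γ Pe) δ) (wPolynomialSub E γ a b Pe) /
          eval (rayPath x (irVector γ Pe) δ) (subgraphPolynomial E γ) +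
        eval (rayPath x (irVector γ Pe) δ) (wPolynomialQuot E γ u w Pe) /
          eval (rayPath x (irVector γ Pe) δ) (quotientPolynomial E γ))) (𝓝[>] 0) (𝓝 (L₁ + L₂)) := by
    simpa only [mul_add] using hB.add hC
  have hlim := hA.div hBC (by rw [← hsum]; exact hLneg.ne)
  rw [← hsum, div_self hLneg.ne] at hlim
  refine (tendsto_congr' ?_).1 hlim
  filter_upwards [self_mem_nhdsWithin] with δ (hδ : 0 < δ)
  have hpow : δ ^ (-(2 : ℝ)) ≠ 0 := (Real.rpow_pos_of_pos hδ _).ne'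
  simp only [Pi.div_apply]
  rw [mul_div_mul_left _ _ hpow]

end Asymptotics

/-! ## §9 (appended, additions only) (25) IN INITIAL-FORM LANGUAGE: `in_β W = V_{G′}·in_β W_{G/G′} + W_{G′}·in_β V_{G/G′}` -/

section InitialForms

variable {N V : ℕ} (E : Fin N → Fin (V + 1) × Fin (V + 1))
variable {γ Pe : Finset (Fin N)} {u w a b : Fin (V + 1)}

/-- **(25) for the initial form of `W`**: under the §5.2 hypotheses in edge-list form and «W/V ≍ δ²» (`ord W = ord V + 2` along the IR
vector), `in_β W = V_{G′} · (W_{G/G′})₂ + W_{G′} · V_{G/(G′∪P₁∪P₂)}` — the δ-leading part of the on-shell denominator, with the companion's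
`initForm`, in closed block form. [cite: Volkov2016, §5.3 (25) (p.1177, PDF p.15 L85–L91) with §5.2 p.1176 (PDF p.13 L29) and App. A (p.1185)] -/
theorem initForm_wPolynomial_irVector (hconn : IsConnectedEdgeList E) (hℓ : loopNumber E (γ ∪ Pe) = loopNumber E γ)
    (hγab : (edgeGraph E γ).Reachable a b) (hPa : (edgeGraph E (Pe \ γ)).Reachable u a)
    (hPb : (edgeGraph E (Pe \ γ)).Reachable b w)
    (h : rayOrder (wPolynomial ℝ E u w Pe) (irVector γ Pe) = rayOrder (kirchhoffPolynomial ℝ E) (irVector γ Pe) + 2) :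
    initForm (wPolynomial ℝ E u w Pe) (irVector γ Pe) =
      subgraphPolynomial E γ * weightPart (wPolynomialQuot E γ u w Pe) (irVector γ Pe) 2 +
        wPolynomialSub E γ a b Pe * quotientPolynomial E (γ ∪ Pe) := by
  rw [(initForm_wPolynomial_irVector_eq E hconn hℓ h).2, weightPart_wPolynomial_irVector E hconn hℓ hγab hPa hPb,
    weightPart_quotientPolynomial_irVector_zero E hℓ]

/-- **(25) as an identity of initial forms, «оставить только доминирующие по степени δ слагаемые»**: if moreover `W_{G/G′}` has a
weight-`2` monomial along the IR vector (its own «W/V ≍ δ²»; otherwise its initial form sits higher and the first term is absent from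
the leading order), then `in_β W = V_{G′} · in_β W_{G/G′} + W_{G′} · in_β V_{G/G′}` with `ord W_{G/G′} = 2`, `ord V_{G/G′} = 0`.
[cite: Volkov2016, §5.3 (25) (p.1177, PDF p.15 L85–L91: «если все величины … расписать в виде суммы произведений, оставить только доминирующие по степени δ слагаемые, то мы получим точные равенства») with App. A (p.1185)] -/
theorem initForm_wPolynomial_irVector_eq_add (hconn : IsConnectedEdgeList E) (hℓ : loopNumber E (γ ∪ Pe) = loopNumber E γ)
    (hγab : (edgeGraph E γ).Reachable a b) (hPa : (edgeGraph E (Pe \ γ)).Reachable u a)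
    (hPb : (edgeGraph E (Pe \ γ)).Reachable b w)
    (h : rayOrder (wPolynomial ℝ E u w Pe) (irVector γ Pe) = rayOrder (kirchhoffPolynomial ℝ E) (irVector γ Pe) + 2)
    (hq : weightPart (wPolynomialQuot E γ u w Pe) (irVector γ Pe) 2 ≠ 0) :
    rayOrder (wPolynomialQuot E γ u w Pe) (irVector γ Pe) = 2 ∧
      initForm (wPolynomial ℝ E u w Pe) (irVector γ Pe) =
        subgraphPolynomial E γ * initForm (wPolynomialQuot E γ u w Pe) (irVector γ Pe) +
          wPolynomialSub E γ a b Pe * initForm (quotientPolynomial E γ) (irVector γ Pe) := by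
  have hW1 := (initForm_wPolynomial_irVector_eq E hconn hℓ h).1
  have hq2 := rayOrder_eq_of_forall_le_of_weightPart_ne_zero
    (fun d hd => two_le_linPair_of_mem_support_wPolynomialQuot E hconn hℓ hγab hPa hPb hW1 hd) hq
  refine ⟨hq2.1, ?_⟩
  rw [hq2.2, (rayOrder_quotientPolynomial_irVector E hℓ).2]
  exact initForm_wPolynomial_irVector E hconn hℓ hγab hPa hPb h

end InitialForms

end Literature.MathematicalPhysics.QuantumFieldTheory.Volkov2016
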